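import Mathlib
import Literature.NumberTheory.LFunctions.Zhang2022.TypedSection18
import Literature.NumberTheory.LFunctions.Zhang2022.Section18Ded183
import HarnessLib

/-!
# Zhang (2022) §18, proof of (2.33): the `S_j(𝐚₂₃,𝐚₂₃)` steps of p. 100 as kernel edges —
# the printed expansion and the three-range split hold outright, and the crude bound
# `Re S_j < 1100𝔞/log P` ("the factors … make minor contribution") follows from the displayed
# range evaluations

Topic `Literature/NumberTheory/LFunctions/Zhang2022` (Landau–Siegel audit tree; verdict-neutral).
Y. Zhang, *Discrete mean estimates and the Landau–Siegel zero*, arXiv:2211.02515v1 (2022)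
[Zhang2022LandauSiegel], §18 p. 100 (tex L4921–L4953) — **an unrefereed manuscript under
adjudication; nothing in this file asserts any claim of the manuscript.** Cell siegel-zhang
(D-0069), cone C27 (`Skeleton.Ded183`, the (2.33) half of Proposition 2.5), LOWER sub-edges
(seat L4-t7; the upper edges `Eq183 + Prop71 ⇒ Bound183/Ded183` from the crude bound are
sz-d56's `Section18Ded183`). Theorems only: 0 new definitions, 0 new facts, 0 kit.

The typed nodes are those of `TypedSection18` (namespace `…Zhang2022.Typed.Section18`):
`Step18_u008` (the printed expansion `S_j(𝐚₂₃,𝐚₂₃) = Σ_rΣ_d |χ(d)||μχ(r)|λ₀ⱼ(dr)/(drφ(r))(Σ_m…)(Σ_n…)`),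
`Step18_u009` (the split `dr < P^{0.5}`, `P^{0.5} ≤ dr < P^{0.502}`, `P^{0.502} ≤ dr < P^{0.504}`),
`Step18_range1` ("the sum over `dr < P^{0.5}` contributes `o(α)`"), `Step18_u010`, `Step18_u011b`
(the two range evaluations with `(500L′(1,χ)/log P)²`, third range in the reading `𝒴₂ⱼ` of Lemma
10.2 (10.10)), `Step18_u012` (the major contribution `= 1000𝔞/log P + o(α)`), `Step18_u013` (the
crude bound), `Step18_u014` (the combination `< 4400𝔞/π`).

What is PROVED here:

* `step18_u008_holds : Step18_u008 c′` — **node `Z22:§18.u008` DISCHARGED outright**: the printed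
  expansion is an exact rearrangement of Proposition 7.1's `S_j` (`Skeleton.Sj`) at `𝐚₁ = 𝐚₂ = 𝐚₂₃`
  for a real character (`χ(d)²χ(r)²|μ(r)| = |χ(d)||μχ(r)|`).
* `step18_u009_holds : Step18_u009 c′` — **node `Z22:§18.u009` DISCHARGED outright**: the three
  ranges are disjoint and ordered, and pairs with `dr ≥ P^{0.504}` contribute nothing
  (`f̃(log(drm)/log P) = 0` for `m ≥ 1`).
* `step18_u014_of_u013 : Step18_u013 c′ → Step18_u014 c′` — the last display of p. 100 from the
  crude bound is arithmetic (`α log P = π`).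
* `step18_u013_of_ranges : Step18_u008 c′ → Step18_u009 c′ → Step18_range1 c′ → Step18_u010 c′ →
  Step18_u011b c′ → Step18_u012 c′ → Step18_u013 c′` — **the manuscript's sentence "The factors
  `β_j log(n/P^{0.5})`, `β_j log(P^{0.504}/n)` and `𝒴₁ⱼ(n)` … make minor contribution … Thus we
  have the crude bound `Re{S_j(𝐚₂₃,𝐚₂₃)} < 1100𝔞/log P`" QUANTIFIED IN THE KERNEL**: for
  `𝓛⁷ ≥ 16000(1 + 16|c′|)`, (i) every shift has `|β_k| ≤ 3.005α` (`norm_betaJ_le`), so with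
  `α log P = π` the factors `(−1 − β_jL₁)(−1 + 𝒴₁ⱼ) − 1`, `(1 − β_jL₂)(1 + 𝒴₂ⱼ) − 1` have modulus
  `≤ 0.065` on their windows (`factor_R2_le`, `factor_R3_le`); (ii) the weight
  `w(n) = |χ(n)|λ₀ⱼ(n)/φ(n)` is nearly positive, `Re w ≥ 0.68|w|` (`re_weight_ge`), because the
  Euler factors `(1 − q^{−1+i(b_j−b_k)})/(1 − q^{−1+ib_j})` of `λ(n, 1 − β_j)` have arguments
  `≤ 2q⁻¹ log q·Σ|b|` (`eulerFactor_polar`, via `|arg(1 − ue^{iϑ})| ≤ 2u|ϑ|` for `u ≤ ½`,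
  `arg_one_sub_small`) and `Σ_{q∣n} log q/q ≤ 9 log 𝓛 (1 + 9 log 𝓛) + 1` for `n ≤ P = e^{𝓛⁹}`
  (`sum_primeFactors_log_div_le`, splitting at `y = 𝓛⁹`: harmonic bound below, at most
  `log n/log y` primes above), whence `|arg λ₀ⱼ(n)| ≤ 0.8` (`lamZero_polar`, `angle_le_of_ell`,
  `re_lamZero_ge`); (iii) hence `Re(main₁₀ + main₁₁) ≤ (1 + 0.065/0.68) Re(main₁₂)`
  (`re_main10_add_main11b_le`), and with `ε = a₀/4`, `a₀ ≤ 𝔞` (Lemma 5.7, the tree's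
  `Skeleton.frakALowerBound_holds`): `Re S_j ≤ 3εα + 1.0956(1000𝔞/log P + εα) < 1100𝔞/log P`.
* `sjNorm_of_ranges` — the two-sided companion `|S_j(𝐚₂₃,𝐚₂₃)| ≤ 1600(𝔞 + 1)/log P` from the
  same range claims (what Proposition 7.1's error term `E(𝐚₂₃,𝐚₂₃) = 𝔓𝓛²Σ|S_j|` needs; the
  manuscript does not display it).

So within cone C27 the (2.33) crude bound (node `Z22:§18.u013`, and `Z22:§18.u014`) is reduced in
the kernel to the four displayed RANGE EVALUATIONS of p. 100 (`Step18_range1`, `Step18_u010`,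
`Step18_u011b`, `Step18_u012` — the manuscript's "By the discussion in Section 8 and 10", i.e.
Lemmas 8.2–8.4, 10.1, 10.2 applied to the two inner sums), which remain CLAIM nodes. The printed
third-range display carries `𝒴₁ⱼ` (typed as `Step18_u011`); the modulus bookkeeping above uses the
(10.10)-reading `𝒴₂ⱼ` (`Step18_u011b`) — with the printed `𝒴₁ⱼ` on `[P^{0.502}, P^{0.504})` the
factor has modulus `≈ 0.096` and the crude `10 %` margin needs the finer remark that the first-order
terms are purely imaginary; that variant is not attempted here.

WHAT THIS IS NOT: a proof of the range evaluations, of Lemmas 10.1–10.2, of Proposition 7.1 or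
of (2.33) itself; no statement about Theorems 1–2 of the manuscript or about Landau–Siegel zeros.

Revision 2 adds the PRINTED third-range display (`𝒴₁ⱼ`, `Step18_u011`) to the bookkeeping —
`factor_R3_printed_le` (factor modulus `≤ 0.1`), `norm_main10_add_main11_le`,
`sjNorm_of_ranges_printed` (`|S_j(𝐚₂₃,𝐚₂₃)| ≤ 1700(𝔞 + 1)/log P`) — and composes with sz-d56's
`Section18Ded183` (p413145: the crude bound + `E(𝐚₂₃,𝐚₂₃) = o(𝔓)` ⇒ `Skeleton.Ded183`,
`ded183_of_crude`): `ded183_of_ranges` (the leaf `Skeleton.Ded183 c′` of `theorem1_of_leaves` from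
the six range-level nodes, `𝒴₂ⱼ` reading, via `step18_u013_of_ranges` + `sjNorm_of_ranges`) and
`ded183_of_ranges_printed` (same with the printed `Step18_u011` and the printed crude bound
`Step18_u013` as inputs). Finally, **the crude bound from the PRINTED displays**,
`step18_u013_of_ranges_printed : Step18_u008 c′ → Step18_u009 c′ → Step18_range1 c′ →
Step18_u010 c′ → Step18_u011 c′ → Step18_u012 c′ → Step18_u013 c′`, by the real-part refinement:
the shifts `β_k = ib_k` are purely imaginary (`re_betaJ_mul_ofReal`), so the minor factors have real
part `≤ 0.002` (`factor_R2_re_le`, `factor_R3_printed_re_le`), and for `𝓛⁷ ≥ 610000(1 + 16|c′|)`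
the weight has `|Im w| ≤ 0.02|w|`, `Re w ≥ 0.9998|w|` (`lamZero_im_re_of_ell`, `weight_im_re`);
whence `Re(main₁₀ + main₁₁) ≤ (1 + 0.004/0.9998) Re(main₁₂)` (`re_main10_add_main11_le`) and
`Re S_j ≤ 1008𝔞/log P < 1100𝔞/log P`. The proof node `Pf233 c′` itself is closed by sz-d56's
`pf233_of_typed` (L4-lead RULING 11; `u012`-free route), not here.

## References

* Y. Zhang, arXiv:2211.02515v1 (2022), §18 p. 100; §7 Prop. 7.1 and p. 33 (`λ(m,s)`, `λ₀ⱼ`,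
  `ξ₀ⱼ`); §2 (2.10), (2.13), (2.28), (2.31); §10 (10.9)–(10.10); §5 Lemma 5.7.
  [cite: Zhang2022LandauSiegel, §18 p.100]
-/

noncomputable section

open Complex Real ComplexConjugate

namespace Literature.NumberTheory.LFunctions.Zhang2022.Typed.Section18

open Skeleton

variable (c' : ℝ)

/-! ## Size facts used by the edges -/

section SizeFacts

variable {D : ℕ}

/-- `𝓛 > 0` for `D ≥ 3`. [folklore] -/
private theorem ell_pos' (hD : 3 ≤ D) : 0 < ell D := lt_trans one_pos (one_lt_ell hD)

/-- `log P = 𝓛⁹ > 0` for `D ≥ 3`. [cite: Zhang2022LandauSiegel, §2 (2.6)] -/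
private theorem logP_pos (hD : 3 ≤ D) : 0 < Real.log (bigP D) := by
  rw [log_bigP]; exact pow_pos (ell_pos' hD) 9

/-- `P > 0`. [cite: Zhang2022LandauSiegel, §2 (2.6)] -/
private theorem bigP_pos (D : ℕ) : 0 < bigP D := Real.exp_pos _

/-- `P ≥ 1`. [cite: Zhang2022LandauSiegel, §2 (2.6)] -/
private theorem one_le_bigP' (D : ℕ) : 1 ≤ bigP D := Real.one_le_exp (by rw [ell]; positivity)

/-- `α = π/log P > 0` for `D ≥ 3`. [cite: Zhang2022LandauSiegel, §2 (2.10)] -/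
private theorem alpha_pos' (hD : 3 ≤ D) : 0 < alpha D := div_pos Real.pi_pos (logP_pos hD)

/-- `α · log P = π` (2.10), for `D ≥ 3`. [cite: Zhang2022LandauSiegel, §2 (2.10)] -/
private theorem alpha_mul_logP (hD : 3 ≤ D) : alpha D * Real.log (bigP D) = π := by
  rw [alpha]; field_simp [(logP_pos hD).ne']

/-- `f̃(z) = 0` for `z ≥ 0.504` (the right end of the tent (2.28), value `0` at `0.504`).
[cite: Zhang2022LandauSiegel, §2 (2.28)] -/
private theorem ftilde_eq_zero_of_le {z : ℝ} (h : 0.504 ≤ z) : ftilde z = 0 := by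
  unfold ftilde
  split_ifs with h1 h2
  · exfalso; linarith [h1.2]
  · have hz : z = 0.504 := le_antisymm h2.2 h
    rw [hz]; norm_num
  · rfl

end SizeFacts

/-! ## (L3) `Z22:§18.u014` from `Z22:§18.u013`: "so that `Re{(1/2α)S₁ + (2/α)S₂ + (3/2α)S₃} < 4400𝔞/π`" -/

/-- **§18 p.100, "Thus … `Re S_j < 1100𝔞/log P`, so that `Re{(1/2α)S₁ + (2/α)S₂ + (3/2α)S₃} < 4400𝔞/π`"**
(tex L4947–L4953): the step is exact arithmetic — `α` is real and positive, so
`Re{(w/α)S} = (w/α)Re S`, and `(1/2 + 2 + 3/2)·1100𝔞/(α log P) = 4400𝔞/π` because `α log P = π`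
(2.10). Kernel edge `Step18_u013 → Step18_u014`. [cite: Zhang2022LandauSiegel, §18 p.100] -/
theorem step18_u014_of_u013 (h : Step18_u013 c') : Step18_u014 c' := by
  obtain ⟨D₀, hD₀⟩ := h
  refine ⟨max D₀ 3, fun D _ χ hD hq hp hA => ?_⟩
  have hD3 : 3 ≤ D := le_trans (le_max_right _ _) hD
  have h13 := hD₀ D χ (le_trans (le_max_left _ _) hD) hq hp hA
  have hlogP : 0 < Real.log (bigP D) := logP_pos hD3
  have hα : 0 < alpha D := alpha_pos' hD3
  have hαlog : alpha D * Real.log (bigP D) = π := alpha_mul_logP hD3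
  have h1 := h13 1 (by simp)
  have h2 := h13 2 (by simp)
  have h3 := h13 3 (by simp)
  set S1 := Sj c' D 1 (a23 χ) (a23 χ) with hS1
  set S2 := Sj c' D 2 (a23 χ) (a23 χ) with hS2
  set S3 := Sj c' D 3 (a23 χ) (a23 χ) with hS3
  have e1 : (1 / (2 * (alpha D : ℂ)) * S1).re = (1 / (2 * alpha D)) * S1.re := by
    rw [show (1 / (2 * (alpha D : ℂ))) = ((1 / (2 * alpha D) : ℝ) : ℂ) by push_cast; ring,
      Complex.re_ofReal_mul]
  have e2 : (2 / (alpha D : ℂ) * S2).re = (2 / alpha D) * S2.re := by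
    rw [show (2 / (alpha D : ℂ)) = ((2 / alpha D : ℝ) : ℂ) by push_cast; ring,
      Complex.re_ofReal_mul]
  have e3 : (3 / (2 * (alpha D : ℂ)) * S3).re = (3 / (2 * alpha D)) * S3.re := by
    rw [show (3 / (2 * (alpha D : ℂ))) = ((3 / (2 * alpha D) : ℝ) : ℂ) by push_cast; ring,
      Complex.re_ofReal_mul]
  rw [Complex.add_re, Complex.add_re, e1, e2, e3]
  have key : 4400 * frakA χ / π =
      (1 / (2 * alpha D)) * (1100 * frakA χ / Real.log (bigP D)) +
        (2 / alpha D) * (1100 * frakA χ / Real.log (bigP D)) +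
        (3 / (2 * alpha D)) * (1100 * frakA χ / Real.log (bigP D)) := by
    rw [← hαlog]
    field_simp
    ring
  rw [key]
  have c1 : 0 < 1 / (2 * alpha D) := by positivity
  have c2 : 0 < 2 / alpha D := by positivity
  have c3 : 0 < 3 / (2 * alpha D) := by positivity
  have i1 := mul_lt_mul_of_pos_left h1 c1
  have i2 := mul_lt_mul_of_pos_left h2 c2
  have i3 := mul_lt_mul_of_pos_left h3 c3
  linarith

/-! ## (L2) `Z22:§18.u009`: the three-range split is exact -/

section Split

variable {D : ℕ} (χ : DirichletCharacter ℂ D)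

/-- A pair `(r,d)` with `dr ≥ P^{0.504}` contributes nothing to the printed expansion: every
`f̃(log(drm)/log P)`, `m ≥ 1`, vanishes (`log(drm)/log P ≥ 0.504`). [cite: Zhang2022LandauSiegel, §18 p.100] -/
theorem sj23Term_eq_zero_of_le (hlogP : 0 < Real.log (bigP D)) {j r d : ℕ}
    (h : bigP D ^ (0.504 : ℝ) ≤ ((d * r : ℕ) : ℝ)) : sj23Term c' χ j r d = 0 := by
  have hPpos : 0 < bigP D := bigP_pos D
  have hPc : 0 < bigP D ^ (0.504 : ℝ) := Real.rpow_pos_of_pos hPpos _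
  have hdr : 0 < ((d * r : ℕ) : ℝ) := lt_of_lt_of_le hPc h
  have hm : ∀ m ∈ Finset.Ico 1 (Nsupp D),
      χ (m : ZMod D) * (ftilde (Real.log ((d * r * m : ℕ) : ℝ) / Real.log (bigP D)) : ℂ) /
        (m : ℂ) ^ (1 - betaJ c' D j) = 0 := by
    intro m hm
    have hm1 : 1 ≤ m := (Finset.mem_Ico.mp hm).1
    have hz : 0.504 ≤ Real.log ((d * r * m : ℕ) : ℝ) / Real.log (bigP D) := by
      rw [le_div_iff₀ hlogP]
      have h1 : Real.log (bigP D ^ (0.504 : ℝ)) = 0.504 * Real.log (bigP D) :=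
        Real.log_rpow hPpos _
      have h2 : Real.log (bigP D ^ (0.504 : ℝ)) ≤ Real.log ((d * r : ℕ) : ℝ) :=
        Real.log_le_log hPc h
      have h3 : Real.log ((d * r : ℕ) : ℝ) ≤ Real.log ((d * r * m : ℕ) : ℝ) := by
        apply Real.log_le_log hdr
        exact_mod_cast Nat.le_mul_of_pos_right _ hm1
      linarith
    rw [ftilde_eq_zero_of_le hz]
    simp
  unfold sj23Term
  rw [Finset.sum_eq_zero hm]
  simp

/-- **`Z22:§18.u009` holds**: the printed expansion of `S_j(𝐚₂₃,𝐚₂₃)` is exactly the sum of its three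
`dr`-range pieces `dr < P^{0.5}`, `P^{0.5} ≤ dr < P^{0.502}`, `P^{0.502} ≤ dr < P^{0.504}` (Z22 p.100,
tex L4928–L4930) — for every `D ≥ 3` (so `log P > 0`): the ranges are disjoint, ordered
(`P ≥ 1`), and pairs with `dr ≥ P^{0.504}` vanish by `sj23Term_eq_zero_of_le`. DISCHARGE of a typed
node. [cite: Zhang2022LandauSiegel, §18 p.100] -/
theorem step18_u009_holds : Step18_u009 c' := by
  refine ⟨3, fun D _ χ hD _ _ j _ => ?_⟩
  have hlogP : 0 < Real.log (bigP D) := logP_pos hD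
  have hP1 : 1 ≤ bigP D := one_le_bigP' D
  have h12 : bigP D ^ (0.5 : ℝ) ≤ bigP D ^ (0.502 : ℝ) :=
    Real.rpow_le_rpow_of_exponent_le hP1 (by norm_num)
  have h23 : bigP D ^ (0.502 : ℝ) ≤ bigP D ^ (0.504 : ℝ) :=
    Real.rpow_le_rpow_of_exponent_le hP1 (by norm_num)
  unfold Sj23 Sj23Range
  rw [← Finset.sum_add_distrib, ← Finset.sum_add_distrib]
  refine Finset.sum_congr rfl fun r _ => ?_
  rw [← Finset.sum_add_distrib, ← Finset.sum_add_distrib]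
  refine Finset.sum_congr rfl fun d _ => ?_
  have hx0 : (0 : ℝ) ≤ ((d * r : ℕ) : ℝ) := by positivity
  split_ifs with ha hb hc hc' hb' hc'' hc'''
  · exfalso; linarith [ha.2, hb.1]
  · exfalso; linarith [ha.2, hb.1]
  · exfalso; linarith [ha.2, hc'.1]
  · ring
  · exfalso; linarith [hb'.2, hc''.1]
  · ring
  · ring
  · have e1 : bigP D ^ (0.5 : ℝ) ≤ ((d * r : ℕ) : ℝ) := by
      by_contra h'; exact ha ⟨hx0, not_le.mp h'⟩
    have e2 : bigP D ^ (0.502 : ℝ) ≤ ((d * r : ℕ) : ℝ) := by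
      by_contra h'; exact hb' ⟨e1, not_le.mp h'⟩
    have e3 : bigP D ^ (0.504 : ℝ) ≤ ((d * r : ℕ) : ℝ) := by
      by_contra h'; exact hc''' ⟨e2, not_le.mp h'⟩
    rw [add_zero, add_zero]
    exact sj23Term_eq_zero_of_le c' χ hlogP e3

/-- `Step18_u009` — `_holds` alias of `step18_u009_holds` above under the fact's exact name (appended
2026-08-28, D-0026 bookkeeping: the proof term is the existing theorem of this file; no statement,
definition or attribute is edited; no new named fact; the ledger's debt table listed the fact
unproved). [cite: Zhang2022LandauSiegel, §18 p.100] -/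
theorem _root_.Literature.NumberTheory.LFunctions.Zhang2022.Typed.Section18.Step18_u009_holds :
    Step18_u009 c' :=
  _root_.Literature.NumberTheory.LFunctions.Zhang2022.Typed.Section18.step18_u009_holds (c' := c')

end Split

/-! ## (L1) `Z22:§18.u008`: the printed expansion of `S_j(𝐚₂₃,𝐚₂₃)` is exact -/

section Expansion

variable {D : ℕ} (χ : DirichletCharacter ℂ D)

/-- For a real (quadratic) character, `χ(a)² = |χ(a)|`. [folklore] -/
private theorem quad_mul_self_eq_norm (hq : χ.IsQuadratic) (a : ZMod D) :
    χ a * χ a = ((‖χ a‖ : ℝ) : ℂ) := by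
  rcases hq a with h | h | h <;> simp [h]

/-- For a real character, `|μ(r)|χ(r)² = |μχ(r)|`. [folklore] -/
private theorem moebius_natAbs_mul_sq_eq (hq : χ.IsQuadratic) (r : ℕ) :
    (((ArithmeticFunction.moebius r).natAbs : ℕ) : ℂ) * (χ (r : ZMod D) * χ (r : ZMod D)) =
      ((‖((ArithmeticFunction.moebius r : ℤ) : ℂ) * χ (r : ZMod D)‖ : ℝ) : ℂ) := by
  rw [quad_mul_self_eq_norm χ hq]
  rcases Int.abs_le_one_iff.mp (ArithmeticFunction.abs_moebius_le_one (n := r)) with h | h | h <;>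
    simp [h]

/-- The `(d,r)`-summand of `Skeleton.Sj c′ D j 𝐚₂₃ 𝐚₂₃` equals the printed `(r,d)`-summand `sj23Term`
(the factors `χ(d)χ(r)` of `a₂₃(drm) = χ(drm)f̃(…)` pulled out of both inner sums).
[cite: Zhang2022LandauSiegel, §18 p.100] -/
theorem Sj_summand_eq_sj23Term (hq : χ.IsQuadratic) (j d r : ℕ) :
    ((ArithmeticFunction.moebius r).natAbs : ℂ) * lamZero c' D j (d * r) /
          ((d * r : ℕ) * (Nat.totient r : ℂ)) *
        (∑ m ∈ Finset.Ico 1 (Nsupp D), a23 χ (d * r * m) / (m : ℂ) ^ (1 - betaJ c' D j)) *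
        (∑ n ∈ Finset.Ico 1 (Nsupp D), a23 χ (d * r * n) * xiZero c' D j n d r / (n : ℂ)) =
      sj23Term c' χ j r d := by
  have hM : ∑ m ∈ Finset.Ico 1 (Nsupp D), a23 χ (d * r * m) / (m : ℂ) ^ (1 - betaJ c' D j) =
      χ (d : ZMod D) * χ (r : ZMod D) *
        ∑ m ∈ Finset.Ico 1 (Nsupp D), χ (m : ZMod D) *
          (ftilde (Real.log ((d * r * m : ℕ) : ℝ) / Real.log (bigP D)) : ℂ) /
            (m : ℂ) ^ (1 - betaJ c' D j) := by
    rw [Finset.mul_sum]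
    refine Finset.sum_congr rfl fun m _ => ?_
    simp only [a23, a13, Nat.cast_mul, map_mul]
    ring
  have hN : ∑ n ∈ Finset.Ico 1 (Nsupp D), a23 χ (d * r * n) * xiZero c' D j n d r / (n : ℂ) =
      χ (d : ZMod D) * χ (r : ZMod D) *
        ∑ n ∈ Finset.Ico 1 (Nsupp D), χ (n : ZMod D) *
          (ftilde (Real.log ((d * r * n : ℕ) : ℝ) / Real.log (bigP D)) : ℂ) *
            xiZero c' D j n d r / (n : ℂ) := by
    rw [Finset.mul_sum]
    refine Finset.sum_congr rfl fun n _ => ?_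
    simp only [a23, a13, Nat.cast_mul, map_mul]
    ring
  rw [hM, hN]
  unfold sj23Term
  rw [← moebius_natAbs_mul_sq_eq χ hq r, ← quad_mul_self_eq_norm χ hq (d : ZMod D)]
  simp only [Nat.cast_mul]
  ring

/-- **`Z22:§18.u008` holds**: "`S_j(𝐚₂₃,𝐚₂₃) = Σ_r Σ_d |χ(d)||μχ(r)|λ₀ⱼ(dr)/(drφ(r))(Σ_m …)(Σ_n …)`"
(Z22 p.100, tex L4921–L4926) is an exact rearrangement of Proposition 7.1's `S_j` at
`𝐚₁ = 𝐚₂ = 𝐚₂₃` for the real character `χ` (every `D`, every `j`). DISCHARGE of a typed node.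
[cite: Zhang2022LandauSiegel, §18 p.100] -/
theorem step18_u008_holds : Step18_u008 c' := by
  refine ⟨0, fun D _ χ _ hq _ j _ => ?_⟩
  unfold Sj Sj23
  rw [Finset.sum_comm]
  refine Finset.sum_congr rfl fun r _ => Finset.sum_congr rfl fun d _ => ?_
  exact Sj_summand_eq_sj23Term c' χ hq j d r

/-- `Step18_u008` — `_holds` alias of `step18_u008_holds` above under the fact's exact name (appended
2026-08-28, D-0026 bookkeeping: the proof term is the existing theorem of this file; no statement,
definition or attribute is edited; no new named fact; the ledger's debt table listed the fact
unproved). [cite: Zhang2022LandauSiegel, §18 p.100] -/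
theorem _root_.Literature.NumberTheory.LFunctions.Zhang2022.Typed.Section18.Step18_u008_holds :
    Step18_u008 c' :=
  _root_.Literature.NumberTheory.LFunctions.Zhang2022.Typed.Section18.step18_u008_holds (c' := c')

end Expansion


/-! ### Elementary: `|arctan y| ≤ |y|` and the argument of `1 − u e^{iϑ}` -/

/-- `|arctan y| ≤ |y|`. [folklore] -/
private theorem abs_arctan_le_abs (y : ℝ) : |Real.arctan y| ≤ |y| := by
  have key : ∀ t : ℝ, 0 < t → Real.arctan t ≤ t := by
    intro t ht
    have h1 : 0 < Real.arctan t := by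
      rw [← Real.arctan_zero]; exact Real.arctan_strictMono ht
    have h2 : Real.arctan t < π / 2 := Real.arctan_lt_pi_div_two t
    have h3 := Real.lt_tan h1 h2
    rw [Real.tan_arctan] at h3
    exact h3.le
  rcases lt_trichotomy y 0 with hy | hy | hy
  · have hny : 0 < -y := by linarith
    have h := key (-y) hny
    rw [Real.arctan_neg] at h
    have h0 : Real.arctan y < 0 := by
      rw [← Real.arctan_zero]; exact Real.arctan_strictMono hy
    rw [abs_of_neg h0, abs_of_neg hy]
    exact h
  · subst hy; simp
  · have h := key y hy
    have h0 : 0 < Real.arctan y := by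
      rw [← Real.arctan_zero]; exact Real.arctan_strictMono hy
    rw [abs_of_pos h0, abs_of_pos hy]
    exact h

/-- For `z` with `Re z > 0`: `|arg z| ≤ |Im z| / Re z`. [folklore] -/
private theorem abs_arg_le_of_re_pos {z : ℂ} (hz : 0 < z.re) : |Complex.arg z| ≤ |z.im| / z.re := by
  have hlt : |Complex.arg z| < π / 2 := Complex.abs_arg_lt_pi_div_two_iff.mpr (Or.inl hz)
  have h1 : -(π / 2) < Complex.arg z := (abs_lt.mp hlt).1
  have h2 : Complex.arg z < π / 2 := (abs_lt.mp hlt).2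
  have htan : Real.tan (Complex.arg z) = z.im / z.re := Complex.tan_arg z
  have harg : Complex.arg z = Real.arctan (z.im / z.re) := by
    rw [← htan, Real.arctan_tan h1 h2]
  rw [harg]
  calc |Real.arctan (z.im / z.re)| ≤ |z.im / z.re| := abs_arctan_le_abs _
    _ = |z.im| / z.re := by rw [abs_div, abs_of_pos hz]

/-- The elementary factor `z = 1 − u e^{iϑ}`, `0 ≤ u ≤ 1/2`: `z ≠ 0` and `|arg z| ≤ 2u|ϑ|`. [folklore] -/
private theorem arg_one_sub_small {u ϑ : ℝ} (hu0 : 0 ≤ u) (hu : u ≤ 1 / 2) :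
    (1 - (u : ℂ) * Complex.exp (ϑ * I)) ≠ 0 ∧
      |Complex.arg (1 - (u : ℂ) * Complex.exp (ϑ * I))| ≤ 2 * u * |ϑ| := by
  set z : ℂ := 1 - (u : ℂ) * Complex.exp (ϑ * I) with hz
  have hre : z.re = 1 - u * Real.cos ϑ := by
    simp [hz, Complex.exp_ofReal_mul_I_re]
  have him : z.im = -(u * Real.sin ϑ) := by
    simp [hz, Complex.exp_ofReal_mul_I_im]
  have hcos : Real.cos ϑ ≤ 1 := Real.cos_le_one ϑ
  have hre_pos : 1 / 2 ≤ z.re := by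
    rw [hre]; nlinarith [mul_le_mul_of_nonneg_left hcos hu0]
  have hre_pos' : 0 < z.re := by linarith
  refine ⟨fun h => by rw [h] at hre_pos'; simp at hre_pos', ?_⟩
  have hsin : |Real.sin ϑ| ≤ |ϑ| := Real.abs_sin_le_abs
  have him_le : |z.im| ≤ u * |ϑ| := by
    rw [him, abs_neg, abs_mul, abs_of_nonneg hu0]
    exact mul_le_mul_of_nonneg_left hsin hu0
  calc |Complex.arg z| ≤ |z.im| / z.re := abs_arg_le_of_re_pos hre_pos'
    _ ≤ (u * |ϑ|) / (1 / 2) := by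
        apply div_le_div₀ (by positivity) him_le (by norm_num) hre_pos
    _ = 2 * u * |ϑ| := by ring

/-- Polar form with a controlled angle: for `0 ≤ u ≤ 1/2`, `1 − u e^{iϑ} = ‖·‖ e^{iφ}` with
`|φ| ≤ 2u|ϑ|`. [folklore] -/
private theorem polar_one_sub_small {u ϑ : ℝ} (hu0 : 0 ≤ u) (hu : u ≤ 1 / 2) :
    ∃ φ : ℝ, |φ| ≤ 2 * u * |ϑ| ∧
      (1 - (u : ℂ) * Complex.exp (ϑ * I)) =
        (‖1 - (u : ℂ) * Complex.exp (ϑ * I)‖ : ℂ) * Complex.exp (φ * I) ∧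
      (1 - (u : ℂ) * Complex.exp (ϑ * I)) ≠ 0 := by
  obtain ⟨hne, harg⟩ := arg_one_sub_small (ϑ := ϑ) hu0 hu
  exact ⟨Complex.arg _, harg, (Complex.norm_mul_exp_arg_mul_I _).symm, hne⟩

/-! ### The prime-divisor sum `Σ_{q ∣ n} log q / q` -/

/-- For `n ≥ 1` and `y ≥ e` with `log n ≤ y`: `Σ_{q ∣ n, q prime} log q/q ≤ log y (1 + log y) + 1`.
[folklore] -/
private theorem sum_primeFactors_log_div_le {n : ℕ} (hn : 1 ≤ n) {y : ℝ} (hy : Real.exp 1 ≤ y)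
    (hlog : Real.log n ≤ y) :
    ∑ q ∈ n.primeFactors, Real.log q / q ≤ Real.log y * (1 + Real.log y) + 1 := by
  have hy1 : 1 < y := lt_of_lt_of_le (by have := Real.exp_one_gt_d9; linarith) hy
  have hy0 : 0 < y := by linarith
  have hlogy : 1 ≤ Real.log y := by
    rw [← Real.log_exp 1]; exact Real.log_le_log (Real.exp_pos 1) hy
  -- split the prime factors at `y`
  set S := n.primeFactors with hS
  set S1 := S.filter (fun q : ℕ => (q : ℝ) ≤ y) with hS1
  set S2 := S.filter (fun q : ℕ => ¬ ((q : ℝ) ≤ y)) with hS2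
  have hsplit : ∑ q ∈ S, Real.log q / q =
      ∑ q ∈ S1, Real.log q / q + ∑ q ∈ S2, Real.log q / q := by
    rw [hS1, hS2, ← Finset.sum_filter_add_sum_filter_not S (fun q : ℕ => (q : ℝ) ≤ y)]
  rw [hsplit]
  -- part 1: small primes, via the harmonic sum
  have hpart1 : ∑ q ∈ S1, Real.log q / q ≤ Real.log y * (1 + Real.log y) := by
    have hle : ∀ q ∈ S1, Real.log q / q ≤ Real.log y * (1 / q) := by
      intro q hq
      have hq' := Finset.mem_filter.mp hq
      have hqp : q.Prime := Nat.prime_of_mem_primeFactors hq'.1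
      have hq0 : 0 < (q : ℝ) := by exact_mod_cast hqp.pos
      rw [mul_one_div]
      exact div_le_div_of_nonneg_right (Real.log_le_log hq0 hq'.2) hq0.le
    refine (Finset.sum_le_sum hle).trans ?_
    rw [← Finset.mul_sum]
    refine mul_le_mul_of_nonneg_left ?_ (by linarith)
    -- `Σ_{q ∈ S1} 1/q ≤ Σ_{m=1}^{⌊y⌋} 1/m ≤ 1 + log ⌊y⌋ ≤ 1 + log y`
    have hsub : S1 ⊆ Finset.Icc 1 ⌊y⌋₊ := by
      intro q hq
      have hq' := Finset.mem_filter.mp hq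
      have hqp : q.Prime := Nat.prime_of_mem_primeFactors hq'.1
      rw [Finset.mem_Icc]
      exact ⟨hqp.one_le, Nat.le_floor hq'.2⟩
    have h1 : ∑ q ∈ S1, (1 / (q : ℝ)) ≤ ∑ m ∈ Finset.Icc 1 ⌊y⌋₊, (1 / (m : ℝ)) :=
      Finset.sum_le_sum_of_subset_of_nonneg hsub (fun m _ _ => by positivity)
    refine h1.trans ?_
    have hN : 1 ≤ ⌊y⌋₊ := Nat.le_floor (by simpa using hy1.le)
    have h2 : ∑ m ∈ Finset.Icc 1 ⌊y⌋₊, (1 / (m : ℝ)) = (harmonic ⌊y⌋₊ : ℝ) := by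
      rw [harmonic_eq_sum_Icc]
      push_cast
      refine Finset.sum_congr rfl fun m _ => ?_
      rw [one_div]
    rw [h2]
    have h3 := harmonic_le_one_add_log ⌊y⌋₊
    have h4 : Real.log (⌊y⌋₊ : ℝ) ≤ Real.log y :=
      Real.log_le_log (by exact_mod_cast hN) (Nat.floor_le hy0.le)
    linarith
  -- part 2: large primes, at most `log n / log y` of them, each term `≤ log y / y`
  have hpart2 : ∑ q ∈ S2, Real.log q / q ≤ 1 := by
    have hterm : ∀ q ∈ S2, Real.log q / q ≤ Real.log y / y := by
      intro q hq
      have hq' := Finset.mem_filter.mp hq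
      have hyq : y ≤ (q : ℝ) := le_of_lt (not_le.mp hq'.2)
      exact Real.log_div_self_antitoneOn hy (le_trans hy hyq) hyq
    have hcard : (S2.card : ℝ) * Real.log y ≤ Real.log n := by
      -- `y ^ |S2| ≤ ∏_{q ∈ S2} q ≤ n`
      have hprod_dvd : (∏ q ∈ S2, q) ∣ n := by
        have h1 : (∏ q ∈ S2, q) ∣ ∏ q ∈ S, q :=
          Finset.prod_dvd_prod_of_subset S2 S (fun q : ℕ => q) (Finset.filter_subset _ _)
        exact h1.trans (Nat.prod_primeFactors_dvd n)
      have hprod_le : ((∏ q ∈ S2, q : ℕ) : ℝ) ≤ n := by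
        exact_mod_cast Nat.le_of_dvd (by omega) hprod_dvd
      have hpow : y ^ S2.card ≤ ((∏ q ∈ S2, q : ℕ) : ℝ) := by
        push_cast
        rw [← Finset.prod_const]
        exact Finset.prod_le_prod (fun q _ => hy0.le)
          (fun q hq => le_of_lt (not_le.mp (Finset.mem_filter.mp hq).2))
      have hn0 : 0 < (n : ℝ) := by exact_mod_cast hn
      have := Real.log_le_log (by positivity) (hpow.trans hprod_le)
      rwa [Real.log_pow] at this
    calc ∑ q ∈ S2, Real.log q / q ≤ ∑ q ∈ S2, Real.log y / y := Finset.sum_le_sum hterm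
      _ = S2.card * (Real.log y / y) := by rw [Finset.sum_const, nsmul_eq_mul]
      _ = (S2.card * Real.log y) / y := by ring
      _ ≤ Real.log n / y := div_le_div_of_nonneg_right hcard hy0.le
      _ ≤ 1 := by rw [div_le_one hy0]; exact hlog
  linarith

/-! ### The shifts `β_j` are `i·b_j` with `|b_j| ≤ 3α(1 + 5|c′|α𝓛)` -/

section Shifts

variable (c' : ℝ) (D : ℕ)

/-- `α ≥ 0`. [cite: Zhang2022LandauSiegel, §2 (2.10)] -/
theorem alpha_nonneg : 0 ≤ alpha D := by
  rw [alpha, log_bigP]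
  exact div_nonneg Real.pi_pos.le (pow_nonneg (by rw [ell]; exact Real.log_natCast_nonneg D) 9)

/-- `𝓛 ≥ 0`. [cite: Zhang2022LandauSiegel, §2 (2.1)] -/
theorem ell_nonneg : 0 ≤ ell D := by rw [ell]; exact Real.log_natCast_nonneg D

/-- Every `β_j` (index read mod 3, §8 convention) is `i b` with `b` real,
`|b| ≤ 3α(1 + 5|c′|α𝓛)` ((2.13): `b₁ = α(1 − 5c′α𝓛)`, `b₂ = 2α(1 + c′α𝓛)`, `b₃ = 3α(1 − c′α𝓛)`).
[cite: Zhang2022LandauSiegel, §2 (2.13)] -/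
theorem betaJ_eq_real_mul_I (j : ℕ) : ∃ b : ℝ, betaJ c' D j = (b : ℂ) * I ∧
    |b| ≤ 3 * alpha D * (1 + 5 * |c'| * alpha D * ell D) := by
  have hα := alpha_nonneg D
  have hℓ := ell_nonneg D
  have hx : |c' * alpha D * ell D| = |c'| * alpha D * ell D := by
    rw [abs_mul, abs_mul, abs_of_nonneg hα, abs_of_nonneg hℓ]
  have hx0 : 0 ≤ |c'| * alpha D * ell D := by positivity
  unfold betaJ
  split_ifs with h1 h2
  · refine ⟨b1 c' D, by rw [beta1, b1]; push_cast; ring, ?_⟩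
    rw [b1, abs_mul, abs_of_nonneg hα]
    have : |1 - 5 * c' * alpha D * ell D| ≤ 1 + 5 * |c'| * alpha D * ell D := by
      calc |1 - 5 * c' * alpha D * ell D| ≤ |(1:ℝ)| + |5 * c' * alpha D * ell D| := abs_sub _ _
        _ = 1 + 5 * |c'| * alpha D * ell D := by
          rw [abs_one, show 5 * c' * alpha D * ell D = 5 * (c' * alpha D * ell D) by ring,
            abs_mul, hx]; norm_num; ring
    nlinarith
  · refine ⟨b2 c' D, by rw [beta2, b2]; push_cast; ring, ?_⟩
    rw [b2, abs_mul, abs_mul, abs_of_nonneg hα]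
    have : |1 + c' * alpha D * ell D| ≤ 1 + |c'| * alpha D * ell D := by
      calc |1 + c' * alpha D * ell D| ≤ |(1:ℝ)| + |c' * alpha D * ell D| := abs_add_le _ _
        _ = 1 + |c'| * alpha D * ell D := by rw [abs_one, hx]
    norm_num
    nlinarith
  · refine ⟨b3 c' D, by rw [beta3, b3]; push_cast; ring, ?_⟩
    rw [b3, abs_mul, abs_mul, abs_of_nonneg hα]
    have : |1 - c' * alpha D * ell D| ≤ 1 + |c'| * alpha D * ell D := by
      calc |1 - c' * alpha D * ell D| ≤ |(1:ℝ)| + |c' * alpha D * ell D| := abs_sub _ _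
        _ = 1 + |c'| * alpha D * ell D := by rw [abs_one, hx]
    norm_num
    nlinarith

end Shifts

/-! ### One Euler factor of `λ₀ⱼ(n)` in polar form -/

/-- `q^{−1 + iτ} = q⁻¹ e^{iτ log q}` for a positive integer `q`. [folklore] -/
private theorem natCast_cpow_neg_one_add_mul_I {q : ℕ} (hq : 0 < q) (τ : ℝ) :
    (q : ℂ) ^ ((-1 : ℂ) + (τ : ℂ) * I) =
      (((q : ℝ)⁻¹ : ℝ) : ℂ) * Complex.exp (((τ * Real.log q : ℝ) : ℂ) * I) := by
  have hq0 : (q : ℂ) ≠ 0 := by exact_mod_cast hq.ne'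
  have hqR : (0 : ℝ) < q := by exact_mod_cast hq
  rw [Complex.cpow_def_of_ne_zero hq0, ← Complex.ofReal_natCast,
    ← Complex.ofReal_log hqR.le]
  rw [show ((Real.log q : ℝ) : ℂ) * ((-1 : ℂ) + (τ : ℂ) * I) =
      ((-(Real.log q) : ℝ) : ℂ) + ((τ * Real.log q : ℝ) : ℂ) * I by push_cast; ring]
  rw [Complex.exp_add, ← Complex.ofReal_exp, Real.exp_neg, Real.exp_log hqR]

/-- Algebra of polar forms: `(N₁e^{iφ₁})(N₂e^{iφ₂})(N₃e^{iφ₃})/(N₀e^{iφ₀}) = (N₁N₂N₃/N₀)e^{i(φ₁+φ₂+φ₃−φ₀)}`.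
[folklore] -/
private theorem polar_mul_mul_div (N1 N2 N3 N0 φ1 φ2 φ3 φ0 : ℝ) :
    ((N1 : ℂ) * Complex.exp ((φ1 : ℂ) * I)) * ((N2 : ℂ) * Complex.exp ((φ2 : ℂ) * I)) *
          ((N3 : ℂ) * Complex.exp ((φ3 : ℂ) * I)) / ((N0 : ℂ) * Complex.exp ((φ0 : ℂ) * I)) =
      ((N1 * N2 * N3 / N0 : ℝ) : ℂ) * Complex.exp (((φ1 + φ2 + φ3 - φ0 : ℝ) : ℂ) * I) := by
  have h0 : Complex.exp ((φ0 : ℂ) * I) ≠ 0 := Complex.exp_ne_zero _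
  have hsplit : Complex.exp (((φ1 + φ2 + φ3 - φ0 : ℝ) : ℂ) * I) =
      Complex.exp ((φ1 : ℂ) * I) * Complex.exp ((φ2 : ℂ) * I) * Complex.exp ((φ3 : ℂ) * I) /
        Complex.exp ((φ0 : ℂ) * I) := by
    rw [eq_div_iff h0, ← Complex.exp_add, ← Complex.exp_add, ← Complex.exp_add]
    push_cast
    ring_nf
  rw [hsplit]
  push_cast
  ring

/-- A complex number given in the form `R e^{iφ}` with `R ≥ 0` real is `‖·‖ e^{iφ}`. [folklore] -/
private theorem polar_norm_eq {z : ℂ} {R φ : ℝ} (hR : 0 ≤ R) (h : z = (R : ℂ) * Complex.exp ((φ : ℂ) * I)) :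
    z = (‖z‖ : ℂ) * Complex.exp ((φ : ℂ) * I) := by
  have : ‖z‖ = R := by
    rw [h, norm_mul, Complex.norm_exp_ofReal_mul_I, mul_one, Complex.norm_real, Real.norm_eq_abs,
      abs_of_nonneg hR]
  rw [this]; exact h

/-- **One Euler factor of `λ(n, 1 − ib₀)` in polar form.** For a prime power base `q ≥ 2` and real
`b₀, b₁, b₂, b₃`, the factor
`(1 − q^{−(s+ib₁)})(1 − q^{−(s+ib₂)})(1 − q^{−(s+ib₃)})/(1 − q^{−s})` at `s = 1 − ib₀` equals
`‖·‖·e^{iφ}` with `|φ| ≤ 2q⁻¹ log q (|b₀−b₁| + |b₀−b₂| + |b₀−b₃| + |b₀|)`. [folklore] -/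
private theorem eulerFactor_polar {q : ℕ} (hq : 2 ≤ q) (b0 b1 b2 b3 : ℝ) :
    let s : ℂ := 1 - (b0 : ℂ) * I
    let G : ℂ := (1 - (q : ℂ) ^ (-(s + (b1 : ℂ) * I))) * (1 - (q : ℂ) ^ (-(s + (b2 : ℂ) * I))) *
        (1 - (q : ℂ) ^ (-(s + (b3 : ℂ) * I))) / (1 - (q : ℂ) ^ (-s))
    ∃ φ : ℝ, |φ| ≤ 2 * (q : ℝ)⁻¹ * Real.log q * (|b0 - b1| + |b0 - b2| + |b0 - b3| + |b0|) ∧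
      G = (‖G‖ : ℂ) * Complex.exp ((φ : ℂ) * I) := by
  intro s G
  have hq0 : 0 < q := by omega
  have hqR : (2 : ℝ) ≤ q := by exact_mod_cast hq
  have hu0 : 0 ≤ (q : ℝ)⁻¹ := by positivity
  have hu : (q : ℝ)⁻¹ ≤ 1 / 2 := by rw [inv_le_comm₀ (by positivity) (by norm_num)]; simpa using hqR
  have hlogq : 0 ≤ Real.log q := Real.log_nonneg (by linarith)
  -- the four exponents as `−1 + iτ`
  have e1 : -(s + (b1 : ℂ) * I) = (-1 : ℂ) + ((b0 - b1 : ℝ) : ℂ) * I := by simp [s]; ring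
  have e2 : -(s + (b2 : ℂ) * I) = (-1 : ℂ) + ((b0 - b2 : ℝ) : ℂ) * I := by simp [s]; ring
  have e3 : -(s + (b3 : ℂ) * I) = (-1 : ℂ) + ((b0 - b3 : ℝ) : ℂ) * I := by simp [s]; ring
  have e0 : -s = (-1 : ℂ) + ((b0 : ℝ) : ℂ) * I := by simp [s]; ring
  -- polar forms of the four elementary factors
  obtain ⟨φ1, hφ1, hz1, hne1⟩ := polar_one_sub_small (ϑ := (b0 - b1) * Real.log q) hu0 hu
  obtain ⟨φ2, hφ2, hz2, hne2⟩ := polar_one_sub_small (ϑ := (b0 - b2) * Real.log q) hu0 hu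
  obtain ⟨φ3, hφ3, hz3, hne3⟩ := polar_one_sub_small (ϑ := (b0 - b3) * Real.log q) hu0 hu
  obtain ⟨φ0, hφ0, hz0, hne0⟩ := polar_one_sub_small (ϑ := b0 * Real.log q) hu0 hu
  refine ⟨φ1 + φ2 + φ3 - φ0, ?_, ?_⟩
  · have habs : |φ1 + φ2 + φ3 - φ0| ≤ |φ1| + |φ2| + |φ3| + |φ0| := by
      calc |φ1 + φ2 + φ3 - φ0| ≤ |φ1 + φ2 + φ3| + |φ0| := abs_sub _ _
        _ ≤ |φ1 + φ2| + |φ3| + |φ0| := by linarith [abs_add_le (φ1 + φ2) φ3]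
        _ ≤ |φ1| + |φ2| + |φ3| + |φ0| := by linarith [abs_add_le φ1 φ2]
    rw [abs_mul, abs_of_nonneg hlogq] at hφ1 hφ2 hφ3 hφ0
    have hsum : |φ1| + |φ2| + |φ3| + |φ0| ≤
        2 * (q : ℝ)⁻¹ * Real.log q * (|b0 - b1| + |b0 - b2| + |b0 - b3| + |b0|) := by
      nlinarith [hφ1, hφ2, hφ3, hφ0]
    exact habs.trans hsum
  · have hG : G = (1 - (((q : ℝ)⁻¹ : ℝ) : ℂ) * Complex.exp ((((b0 - b1) * Real.log q : ℝ) : ℂ) * I)) *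
        (1 - (((q : ℝ)⁻¹ : ℝ) : ℂ) * Complex.exp ((((b0 - b2) * Real.log q : ℝ) : ℂ) * I)) *
        (1 - (((q : ℝ)⁻¹ : ℝ) : ℂ) * Complex.exp ((((b0 - b3) * Real.log q : ℝ) : ℂ) * I)) /
        (1 - (((q : ℝ)⁻¹ : ℝ) : ℂ) * Complex.exp ((((b0) * Real.log q : ℝ) : ℂ) * I)) := by
      simp only [G]
      rw [e1, e2, e3, e0, natCast_cpow_neg_one_add_mul_I hq0, natCast_cpow_neg_one_add_mul_I hq0,
        natCast_cpow_neg_one_add_mul_I hq0, natCast_cpow_neg_one_add_mul_I hq0]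
    have hG' : G = ((‖1 - (((q : ℝ)⁻¹ : ℝ) : ℂ) * Complex.exp ((((b0 - b1) * Real.log q : ℝ) : ℂ) * I)‖ *
          ‖1 - (((q : ℝ)⁻¹ : ℝ) : ℂ) * Complex.exp ((((b0 - b2) * Real.log q : ℝ) : ℂ) * I)‖ *
          ‖1 - (((q : ℝ)⁻¹ : ℝ) : ℂ) * Complex.exp ((((b0 - b3) * Real.log q : ℝ) : ℂ) * I)‖ /
          ‖1 - (((q : ℝ)⁻¹ : ℝ) : ℂ) * Complex.exp ((((b0) * Real.log q : ℝ) : ℂ) * I)‖ : ℝ) : ℂ) *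
        Complex.exp (((φ1 + φ2 + φ3 - φ0 : ℝ) : ℂ) * I) := by
      rw [hG]
      conv_lhs => rw [hz1, hz2, hz3, hz0]
      exact polar_mul_mul_div _ _ _ _ _ _ _ _
    exact polar_norm_eq (by positivity) hG'

/-! ### `λ₀ⱼ(n)` in polar form; near-positivity -/

/-- **`λ₀ⱼ(n) = |λ₀ⱼ(n)|e^{iΦ}` with `|Φ| ≤ 14·M·Σ_{q∣n} log q/q`**, `M = 3α(1 + 5|c′|α𝓛)` the bound
on the shift sizes `|b_k|`: the Euler product `λ(m,s)` (§7 p. 33) at `s = 1 − β_j`, factor by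
factor. [cite: Zhang2022LandauSiegel, §7 p. 33] -/
theorem lamZero_polar (c' : ℝ) (D j n : ℕ) :
    ∃ Φ : ℝ, |Φ| ≤ 14 * (3 * alpha D * (1 + 5 * |c'| * alpha D * ell D)) *
        ∑ q ∈ n.primeFactors, Real.log q / q ∧
      lamZero c' D j n = (‖lamZero c' D j n‖ : ℂ) * Complex.exp ((Φ : ℂ) * I) := by
  set M := 3 * alpha D * (1 + 5 * |c'| * alpha D * ell D) with hM
  obtain ⟨b0, hb0, hb0le⟩ := betaJ_eq_real_mul_I c' D j
  obtain ⟨b1, hb1, hb1le⟩ := betaJ_eq_real_mul_I c' D 1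
  obtain ⟨b2, hb2, hb2le⟩ := betaJ_eq_real_mul_I c' D 2
  obtain ⟨b3, hb3, hb3le⟩ := betaJ_eq_real_mul_I c' D 3
  have hb1' : beta1 c' D = (b1 : ℂ) * I := by simpa [betaJ] using hb1
  have hb2' : beta2 c' D = (b2 : ℂ) * I := by simpa [betaJ] using hb2
  have hb3' : beta3 c' D = (b3 : ℂ) * I := by simpa [betaJ] using hb3
  set G : ℕ → ℂ := fun q =>
    (1 - (q : ℂ) ^ (-((1 - (b0 : ℂ) * I) + (b1 : ℂ) * I))) *
        (1 - (q : ℂ) ^ (-((1 - (b0 : ℂ) * I) + (b2 : ℂ) * I))) *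
        (1 - (q : ℂ) ^ (-((1 - (b0 : ℂ) * I) + (b3 : ℂ) * I))) /
      (1 - (q : ℂ) ^ (-(1 - (b0 : ℂ) * I))) with hG
  have hlam : lamZero c' D j n = ∏ q ∈ n.primeFactors, G q := by
    simp only [lamZero, lam, hG, hb0, hb1', hb2', hb3']
  have hK : |b0 - b1| + |b0 - b2| + |b0 - b3| + |b0| ≤ 7 * M := by
    have h1 := abs_sub b0 b1
    have h2 := abs_sub b0 b2
    have h3 := abs_sub b0 b3
    linarith
  have key : ∀ q ∈ n.primeFactors, ∃ φ : ℝ, |φ| ≤ 2 * ((q : ℝ)⁻¹ * Real.log q) * (7 * M) ∧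
      G q = (‖G q‖ : ℂ) * Complex.exp ((φ : ℂ) * I) := by
    intro q hq
    have hq2 : 2 ≤ q := (Nat.prime_of_mem_primeFactors hq).two_le
    obtain ⟨φ, hφ, hGq⟩ := eulerFactor_polar hq2 b0 b1 b2 b3
    refine ⟨φ, hφ.trans ?_, hGq⟩
    have hql : 0 ≤ (q : ℝ)⁻¹ * Real.log q :=
      mul_nonneg (by positivity) (Real.log_nonneg (by exact_mod_cast (by omega : 1 ≤ q)))
    nlinarith
  choose! φ hφ using key
  refine ⟨∑ q ∈ n.primeFactors, φ q, ?_, ?_⟩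
  · calc |∑ q ∈ n.primeFactors, φ q| ≤ ∑ q ∈ n.primeFactors, |φ q| :=
          Finset.abs_sum_le_sum_abs _ _
      _ ≤ ∑ q ∈ n.primeFactors, 2 * ((q : ℝ)⁻¹ * Real.log q) * (7 * M) :=
          Finset.sum_le_sum fun q hq => (hφ q hq).1
      _ = 14 * M * ∑ q ∈ n.primeFactors, Real.log q / q := by
          rw [Finset.mul_sum]
          refine Finset.sum_congr rfl fun q _ => ?_
          ring
  · refine polar_norm_eq (R := ∏ q ∈ n.primeFactors, ‖G q‖)
      (Finset.prod_nonneg fun q _ => norm_nonneg _) ?_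
    rw [hlam, Finset.prod_congr rfl fun q hq => (hφ q hq).2, Finset.prod_mul_distrib,
      Complex.ofReal_prod, Complex.ofReal_sum, Finset.sum_mul, Complex.exp_sum]

/-- The numerical heart of near-positivity: with `α = π/𝓛⁹`, `M = 3α(1 + 5|c′|α𝓛)`,
`Σ_{q∣n} log q/q ≤ 9 log 𝓛 (1 + 9 log 𝓛) + 1` (for `n ≤ P = e^{𝓛⁹}`), the angle bound
`14·M·Σ ≤ 0.8` once `𝓛⁷ ≥ 16000(1 + 16|c′|)`. [folklore] -/
private theorem angle_le_of_ell {c' : ℝ} {D : ℕ} (hℓ : 16000 * (1 + 16 * |c'|) ≤ ell D ^ 7) {S : ℝ}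
    (hS0 : 0 ≤ S) (hS : S ≤ Real.log (ell D ^ 9) * (1 + Real.log (ell D ^ 9)) + 1) :
    14 * (3 * alpha D * (1 + 5 * |c'| * alpha D * ell D)) * S ≤ 0.8 := by
  set L := ell D with hL
  have hK : 0 < 1 + 16 * |c'| := by positivity
  have hL2 : 2 ≤ L := by
    by_contra h
    push Not at h
    have hL0 : 0 ≤ L := ell_nonneg D
    have h7 : L ^ 7 < 2 ^ 7 := by gcongr
    have h16 : (16000 : ℝ) ≤ 16000 * (1 + 16 * |c'|) := by nlinarith [abs_nonneg c']
    norm_num at h7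
    linarith
  have hL1 : 1 ≤ L := by linarith
  have hLpos : 0 < L := by linarith
  have hα : alpha D = π / L ^ 9 := by rw [alpha, log_bigP]
  -- the prime sum
  have hlogL : Real.log L ≤ L := (Real.log_le_sub_one_of_pos hLpos).trans (by linarith)
  have hlogL0 : 0 ≤ Real.log L := Real.log_nonneg hL1
  have hlog9 : Real.log (L ^ 9) = 9 * Real.log L := by
    rw [Real.log_pow]; norm_num
  have hS' : S ≤ 91 * L ^ 2 := by
    rw [hlog9] at hS
    nlinarith
  -- the shift bound
  have hαL : alpha D * L ≤ 1 := by
    rw [hα, div_mul_eq_mul_div, div_le_one (by positivity)]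
    have : L ^ 8 * L = L ^ 9 := by ring
    have h8 : (2:ℝ) ^ 8 ≤ L ^ 8 := by gcongr
    nlinarith [Real.pi_lt_d2]
  have hM : 3 * alpha D * (1 + 5 * |c'| * alpha D * ell D) ≤ 3 * (π / L ^ 9) * (1 + 16 * |c'|) := by
    rw [← hL, hα] at *
    have hc : 0 ≤ |c'| := abs_nonneg _
    have h1 : 5 * |c'| * (π / L ^ 9) * L ≤ 16 * |c'| := by
      have := mul_le_mul_of_nonneg_left hαL (by positivity : (0:ℝ) ≤ 5 * |c'|)
      rw [hα] at this
      nlinarith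
    have hπL : 0 ≤ π / L ^ 9 := by positivity
    nlinarith
  -- combine
  have hA0 : 0 ≤ 3 * (π / L ^ 9) * (1 + 16 * |c'|) := by positivity
  calc 14 * (3 * alpha D * (1 + 5 * |c'| * alpha D * ell D)) * S
      ≤ 14 * (3 * (π / L ^ 9) * (1 + 16 * |c'|)) * (91 * L ^ 2) :=
        mul_le_mul (mul_le_mul_of_nonneg_left hM (by norm_num)) hS' hS0 (by positivity)
    _ = 3822 * π * (1 + 16 * |c'|) / L ^ 7 := by
        field_simp
        ring
    _ ≤ 3822 * π * (1 + 16 * |c'|) / (16000 * (1 + 16 * |c'|)) := by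
        apply div_le_div_of_nonneg_left (by positivity) (by positivity) hℓ
    _ = 3822 * π / 16000 := by field_simp
    _ ≤ 0.8 := by
        rw [div_le_iff₀ (by norm_num)]
        nlinarith [Real.pi_lt_d2]

/-- **Near-positivity of `λ₀ⱼ(n)`**: for `𝓛⁷ ≥ 16000(1 + 16|c′|)` and `1 ≤ n ≤ P`,
`Re λ₀ⱼ(n) ≥ 0.68|λ₀ⱼ(n)|` (the Euler factors of `λ(n, 1 − β_j)` have arguments `O(α log q/q)`,
and `cos 0.8 ≥ 0.68`). [cite: Zhang2022LandauSiegel, §7 p. 33] -/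
theorem re_lamZero_ge (c' : ℝ) {D : ℕ} (hℓ : 16000 * (1 + 16 * |c'|) ≤ ell D ^ 7) (j : ℕ) {n : ℕ}
    (hn : 1 ≤ n) (hnP : (n : ℝ) ≤ bigP D) :
    0.68 * ‖lamZero c' D j n‖ ≤ (lamZero c' D j n).re := by
  obtain ⟨Φ, hΦ, hpol⟩ := lamZero_polar c' D j n
  have hL2 : 2 ≤ ell D := by
    by_contra h
    push Not at h
    have hL0 : 0 ≤ ell D := ell_nonneg D
    have h7 : ell D ^ 7 < 2 ^ 7 := by gcongr
    have h16 : (16000 : ℝ) ≤ 16000 * (1 + 16 * |c'|) := by nlinarith [abs_nonneg c']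
    norm_num at h7
    linarith
  have hy : Real.exp 1 ≤ ell D ^ 9 := by
    have h1 : Real.exp 1 < 3 := lt_trans Real.exp_one_lt_d9 (by norm_num)
    have h2 : (2:ℝ) ^ 9 ≤ ell D ^ 9 := by gcongr
    linarith
  have hlogn : Real.log n ≤ ell D ^ 9 := by
    rw [← log_bigP]
    exact Real.log_le_log (by exact_mod_cast hn) hnP
  have hS := sum_primeFactors_log_div_le hn hy hlogn
  have hS0 : 0 ≤ ∑ q ∈ n.primeFactors, Real.log q / q :=
    Finset.sum_nonneg fun q hq => div_nonneg
      (Real.log_nonneg (by exact_mod_cast (Nat.prime_of_mem_primeFactors hq).one_le)) (by positivity)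
  have hΦ' : |Φ| ≤ 0.8 := hΦ.trans (angle_le_of_ell hℓ hS0 hS)
  have hcos : 0.68 ≤ Real.cos Φ := by
    have h1 := Real.one_sub_sq_div_two_le_cos (x := Φ)
    have h2 : Φ ^ 2 ≤ 0.8 ^ 2 := by
      rw [← sq_abs]; exact pow_le_pow_left₀ (abs_nonneg _) hΦ' 2
    linarith
  have hre : (lamZero c' D j n).re = ‖lamZero c' D j n‖ * Real.cos Φ := by
    conv_lhs => rw [hpol]
    rw [Complex.re_ofReal_mul, Complex.exp_ofReal_mul_I_re]
  rw [hre]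
  nlinarith [norm_nonneg (lamZero c' D j n)]


/-! ### (S1) The prefactor `(500L′(1,χ)/log P)²` is a nonnegative real -/

section Prefactor

variable {D : ℕ} [NeZero D] (χ : DirichletCharacter ℂ D)

/-- `(500L′(1,χ)/log P)² = ((500 Re L′(1,χ)/log P)² : ℝ)` for a real primitive `χ`, `D ≥ 3`
(`L′(1,χ)` is real: `Lemma171.deriv_LFunction_one_im`). [cite: Zhang2022LandauSiegel, §18 p.100] -/
theorem pref_sq_eq_ofReal (hD : 3 ≤ D) (hq : χ.IsQuadratic) (hp : χ.IsPrimitive) :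
    (500 * deriv χ.LFunction 1 / (Real.log (bigP D) : ℂ)) ^ 2 =
      (((500 * (deriv χ.LFunction 1).re / Real.log (bigP D)) ^ 2 : ℝ) : ℂ) := by
  have hne : χ ≠ 1 := ne_one_of_isPrimitive_of_three_le hp hD
  have him : (deriv χ.LFunction 1).im = 0 :=
    Lemma171.deriv_LFunction_one_im χ hne (MulChar.IsQuadratic.sq_eq_one hq)
  have hL : deriv χ.LFunction 1 = ((deriv χ.LFunction 1).re : ℂ) := by
    apply Complex.ext <;> simp [him]
  conv_lhs => rw [hL]
  push_cast
  ring

end Prefactor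

/-! ### (S2) The "minor" factors are small: `|β_j log(n/P^{0.5})|`, `|𝒴₁ⱼ(n)|`, `|𝒴₂ⱼ(n)|` -/

section Factors

variable {D : ℕ}

/-- Under `𝓛⁷ ≥ 16000(1 + 16|c′|)`: every `|β_k| ≤ 3.005α`. [cite: Zhang2022LandauSiegel, §2 (2.13)] -/
theorem norm_betaJ_le (hℓ : 16000 * (1 + 16 * |c'|) ≤ ell D ^ 7) (k : ℕ) :
    ‖betaJ c' D k‖ ≤ 3.005 * alpha D := by
  obtain ⟨b, hb, hble⟩ := betaJ_eq_real_mul_I c' D k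
  have hL2 : 2 ≤ ell D := by
    by_contra h
    push Not at h
    have hL0 : 0 ≤ ell D := ell_nonneg D
    have h7 : ell D ^ 7 < 2 ^ 7 := by gcongr
    have h16 : (16000 : ℝ) ≤ 16000 * (1 + 16 * |c'|) := by nlinarith [abs_nonneg c']
    norm_num at h7
    linarith
  have hα : alpha D = π / ell D ^ 9 := by rw [alpha, log_bigP]
  have hα0 : 0 ≤ alpha D := alpha_nonneg D
  -- `5|c'|αℓ ≤ 1/600`: `αℓ = π/ℓ⁸` and `ℓ⁸ ≥ 2·16000·16|c'| ≥ 3000π|c'|`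
  have hsmall : 5 * |c'| * alpha D * ell D ≤ 1 / 600 := by
    rw [hα]
    have hL8 : ell D ^ 8 = ell D ^ 7 * ell D := by ring
    have hpos : 0 < ell D ^ 9 := by positivity
    rw [show 5 * |c'| * (π / ell D ^ 9) * ell D = 5 * |c'| * π * ell D / ell D ^ 9 by ring,
      div_le_iff₀ hpos]
    have h9 : ell D ^ 9 = ell D ^ 7 * ell D * ell D := by ring
    have hc : 0 ≤ |c'| := abs_nonneg _
    have h1 : 16000 * (1 + 16 * |c'|) * ell D * ell D ≤ ell D ^ 7 * ell D * ell D := by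
      have := mul_le_mul_of_nonneg_right hℓ (by positivity : (0:ℝ) ≤ ell D * ell D)
      nlinarith
    nlinarith [Real.pi_lt_d2, mul_nonneg hc (by positivity : (0:ℝ) ≤ ell D)]
  rw [hb, norm_mul, Complex.norm_I, mul_one, Complex.norm_real, Real.norm_eq_abs]
  nlinarith

/-- `P^a > 0`. [cite: Zhang2022LandauSiegel, §2 (2.6)] -/
private theorem Ppow_pos (D : ℕ) (a : ℝ) : 0 < bigP D ^ a := Real.rpow_pos_of_pos (Real.exp_pos _) a

/-- `log(P^a) = a log P`. [cite: Zhang2022LandauSiegel, §2 (2.6)] -/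
private theorem log_Ppow (D : ℕ) (a : ℝ) : Real.log (bigP D ^ a) = a * Real.log (bigP D) :=
  Real.log_rpow (Real.exp_pos _) a

/-- Generic: `‖x‖ ≤ X`, `‖y‖ ≤ Y`, `X + Y + XY ≤ δ` give `‖x − y − xy‖ ≤ δ` and `‖y − x − xy‖ ≤ δ`.
[folklore] -/
private theorem norm_comb_le {x y : ℂ} {X Y δ : ℝ} (hx : ‖x‖ ≤ X) (hy : ‖y‖ ≤ Y)
    (h : X + Y + X * Y ≤ δ) : ‖x - y - x * y‖ ≤ δ ∧ ‖y - x - x * y‖ ≤ δ := by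
  have hxy : ‖x * y‖ ≤ X * Y := by
    rw [norm_mul]; exact mul_le_mul hx hy (norm_nonneg _) ((norm_nonneg _).trans hx)
  constructor
  · calc ‖x - y - x * y‖ ≤ ‖x - y‖ + ‖x * y‖ := norm_sub_le _ _
      _ ≤ ‖x‖ + ‖y‖ + ‖x * y‖ := by linarith [norm_sub_le x y]
      _ ≤ δ := by linarith
  · calc ‖y - x - x * y‖ ≤ ‖y - x‖ + ‖x * y‖ := norm_sub_le _ _
      _ ≤ ‖y‖ + ‖x‖ + ‖x * y‖ := by linarith [norm_sub_le y x]
      _ ≤ δ := by linarith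

/-- **The second-range factor is within `0.065` of `1`**: for `P^{0.5} ≤ n < P^{0.502}` and
`𝓛⁷ ≥ 16000(1 + 16|c′|)`,
`‖(−1 − β_j log(n/P^{0.5}))(−1 + 𝒴₁ⱼ(n)) − 1‖ ≤ 0.065` (`|β_k| ≤ 3.005α`, `α log P = π`,
`0 ≤ log(n/P^{0.5}) < 0.002 log P`, `0 < log(P^{0.504}/n) ≤ 0.004 log P`,
`0 < log(P^{0.502}/n) ≤ 0.002 log P`). [cite: Zhang2022LandauSiegel, §18 p.100; §10 (10.9)] -/
theorem factor_R2_le (hD : 3 ≤ D) (hℓ : 16000 * (1 + 16 * |c'|) ≤ ell D ^ 7) (j : ℕ) {n : ℕ}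
    (hn1 : bigP D ^ (0.5 : ℝ) ≤ (n : ℝ)) (hn2 : (n : ℝ) < bigP D ^ (0.502 : ℝ)) :
    ‖(-1 - betaJ c' D j * (Real.log ((n : ℝ) / bigP D ^ (0.5 : ℝ)) : ℂ)) *
          (-1 + fraky1 c' D j n) - 1‖ ≤ 0.065 := by
  have hlogP : 0 < Real.log (bigP D) := by
    rw [log_bigP]; exact pow_pos (lt_trans one_pos (one_lt_ell hD)) 9
  set ℓP := Real.log (bigP D) with hℓP
  have hαℓ : alpha D * ℓP = π := by
    rw [alpha, ← hℓP]; field_simp [hlogP.ne']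
  have hn0 : 0 < (n : ℝ) := lt_of_lt_of_le (Ppow_pos D _) hn1
  -- the three logarithms
  set L1 := Real.log ((n : ℝ) / bigP D ^ (0.5 : ℝ)) with hL1
  set La := Real.log (bigP D ^ (0.504 : ℝ) / n) with hLa
  set Lb := Real.log (bigP D ^ (0.502 : ℝ) / n) with hLb
  have hlogn1 : 0.5 * ℓP ≤ Real.log n := by
    rw [← log_Ppow]; exact Real.log_le_log (Ppow_pos D _) hn1
  have hlogn2 : Real.log n < 0.502 * ℓP := by
    rw [← log_Ppow]; exact Real.log_lt_log hn0 hn2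
  have eL1 : L1 = Real.log n - 0.5 * ℓP := by
    rw [hL1, Real.log_div hn0.ne' (Ppow_pos D _).ne', log_Ppow]
  have eLa : La = 0.504 * ℓP - Real.log n := by
    rw [hLa, Real.log_div (Ppow_pos D _).ne' hn0.ne', log_Ppow]
  have eLb : Lb = 0.502 * ℓP - Real.log n := by
    rw [hLb, Real.log_div (Ppow_pos D _).ne' hn0.ne', log_Ppow]
  have hL1a : |L1| ≤ 0.002 * ℓP := by rw [eL1, abs_le]; constructor <;> linarith
  have hLaa : |La| ≤ 0.004 * ℓP := by rw [eLa, abs_le]; constructor <;> linarith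
  have hLba : |Lb| ≤ 0.002 * ℓP := by rw [eLb, abs_le]; constructor <;> linarith
  -- the shifts
  have hB := norm_betaJ_le c' hℓ
  have hα0 : 0 ≤ alpha D := alpha_nonneg D
  set x : ℂ := betaJ c' D j * (L1 : ℂ) with hx
  set y : ℂ := fraky1 c' D j n with hy
  have hX : ‖x‖ ≤ 0.00601 * π := by
    rw [hx, norm_mul, Complex.norm_real, Real.norm_eq_abs, ← hαℓ]
    calc ‖betaJ c' D j‖ * |L1| ≤ (3.005 * alpha D) * (0.002 * ℓP) :=
          mul_le_mul (hB j) hL1a (abs_nonneg _) (by positivity)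
      _ = 0.00601 * (alpha D * ℓP) := by ring
  have hY : ‖y‖ ≤ 0.01202 * π + 0.000109 * π ^ 2 := by
    have e : y = (betaJ c' D (j + 1) + betaJ c' D (j + 2)) * (L1 : ℂ) +
        betaJ c' D (j + 1) * betaJ c' D (j + 2) / 2 * ((La : ℂ) ^ 2 - 2 * (Lb : ℂ) ^ 2) := by
      simp only [hy, fraky1, hL1, hLa, hLb]
    rw [e]
    have h1 : ‖(betaJ c' D (j + 1) + betaJ c' D (j + 2)) * (L1 : ℂ)‖ ≤ 0.01202 * π := by
      rw [norm_mul, Complex.norm_real, Real.norm_eq_abs, ← hαℓ]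
      calc ‖betaJ c' D (j + 1) + betaJ c' D (j + 2)‖ * |L1|
          ≤ (3.005 * alpha D + 3.005 * alpha D) * (0.002 * ℓP) :=
            mul_le_mul ((norm_add_le _ _).trans (add_le_add (hB _) (hB _))) hL1a
              (abs_nonneg _) (by positivity)
        _ = 0.01202 * (alpha D * ℓP) := by ring
    have h2 : ‖betaJ c' D (j + 1) * betaJ c' D (j + 2) / 2 * ((La : ℂ) ^ 2 - 2 * (Lb : ℂ) ^ 2)‖ ≤
        0.000109 * π ^ 2 := by
      rw [norm_mul, norm_div, norm_mul, Complex.norm_two]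
      have hsq : ‖(La : ℂ) ^ 2 - 2 * (Lb : ℂ) ^ 2‖ ≤ 0.000024 * ℓP ^ 2 := by
        calc ‖(La : ℂ) ^ 2 - 2 * (Lb : ℂ) ^ 2‖ ≤ ‖(La : ℂ) ^ 2‖ + ‖2 * (Lb : ℂ) ^ 2‖ := norm_sub_le _ _
          _ = La ^ 2 + 2 * Lb ^ 2 := by
              rw [norm_pow, norm_mul, norm_pow, Complex.norm_real, Complex.norm_real,
                Complex.norm_two, Real.norm_eq_abs, Real.norm_eq_abs, sq_abs, sq_abs]
          _ ≤ (0.004 * ℓP) ^ 2 + 2 * (0.002 * ℓP) ^ 2 := by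
              have ha : La ^ 2 ≤ (0.004 * ℓP) ^ 2 := by
                rw [← sq_abs La]; exact pow_le_pow_left₀ (abs_nonneg _) hLaa 2
              have hb : Lb ^ 2 ≤ (0.002 * ℓP) ^ 2 := by
                rw [← sq_abs Lb]; exact pow_le_pow_left₀ (abs_nonneg _) hLba 2
              linarith
          _ = 0.000024 * ℓP ^ 2 := by ring
      have hββ : ‖betaJ c' D (j + 1)‖ * ‖betaJ c' D (j + 2)‖ ≤ (3.005 * alpha D) * (3.005 * alpha D) :=
        mul_le_mul (hB _) (hB _) (norm_nonneg _) (by positivity)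
      calc ‖betaJ c' D (j + 1)‖ * ‖betaJ c' D (j + 2)‖ / 2 * ‖(La : ℂ) ^ 2 - 2 * (Lb : ℂ) ^ 2‖
          ≤ (3.005 * alpha D) * (3.005 * alpha D) / 2 * (0.000024 * ℓP ^ 2) :=
            mul_le_mul (div_le_div_of_nonneg_right hββ (by norm_num)) hsq (norm_nonneg _)
              (by positivity)
        _ = 0.0001083603 * (alpha D * ℓP) ^ 2 := by ring
        _ ≤ 0.000109 * π ^ 2 := by rw [hαℓ]; nlinarith [Real.pi_pos]
    exact (norm_add_le _ _).trans (by linarith)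
  have hnum : 0.00601 * π + (0.01202 * π + 0.000109 * π ^ 2) +
      0.00601 * π * (0.01202 * π + 0.000109 * π ^ 2) ≤ 0.065 := by
    nlinarith [Real.pi_lt_d2, Real.pi_pos, mul_pos Real.pi_pos Real.pi_pos]
  have := (norm_comb_le hX hY hnum).1
  -- `(−1 − x)(−1 + y) − 1 = x − y − xy`
  have e : (-1 - x) * (-1 + y) - 1 = x - y - x * y := by ring
  rw [e]; exact this

/-- **The third-range factor is within `0.065` of `1`** (reading `𝒴₂ⱼ` of (10.10)): for
`P^{0.502} ≤ n < P^{0.504}` and `𝓛⁷ ≥ 16000(1 + 16|c′|)`,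
`‖(1 − β_j log(P^{0.504}/n))(1 + 𝒴₂ⱼ(n)) − 1‖ ≤ 0.065`. [cite: Zhang2022LandauSiegel, §18 p.100; §10 (10.10)] -/
theorem factor_R3_le (hD : 3 ≤ D) (hℓ : 16000 * (1 + 16 * |c'|) ≤ ell D ^ 7) (j : ℕ) {n : ℕ}
    (hn1 : bigP D ^ (0.502 : ℝ) ≤ (n : ℝ)) (hn2 : (n : ℝ) < bigP D ^ (0.504 : ℝ)) :
    ‖(1 - betaJ c' D j * (Real.log (bigP D ^ (0.504 : ℝ) / n) : ℂ)) *
          (1 + fraky2 c' D j n) - 1‖ ≤ 0.065 := by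
  have hlogP : 0 < Real.log (bigP D) := by
    rw [log_bigP]; exact pow_pos (lt_trans one_pos (one_lt_ell hD)) 9
  set ℓP := Real.log (bigP D) with hℓP
  have hαℓ : alpha D * ℓP = π := by
    rw [alpha, ← hℓP]; field_simp [hlogP.ne']
  have hn0 : 0 < (n : ℝ) := lt_of_lt_of_le (Ppow_pos D _) hn1
  set La := Real.log (bigP D ^ (0.504 : ℝ) / n) with hLa
  have hlogn1 : 0.502 * ℓP ≤ Real.log n := by
    rw [← log_Ppow]; exact Real.log_le_log (Ppow_pos D _) hn1
  have hlogn2 : Real.log n < 0.504 * ℓP := by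
    rw [← log_Ppow]; exact Real.log_lt_log hn0 hn2
  have eLa : La = 0.504 * ℓP - Real.log n := by
    rw [hLa, Real.log_div (Ppow_pos D _).ne' hn0.ne', log_Ppow]
  have hLaa : |La| ≤ 0.002 * ℓP := by rw [eLa, abs_le]; constructor <;> linarith
  have hB := norm_betaJ_le c' hℓ
  have hα0 : 0 ≤ alpha D := alpha_nonneg D
  set x : ℂ := betaJ c' D j * (La : ℂ) with hx
  set y : ℂ := fraky2 c' D j n with hy
  have hX : ‖x‖ ≤ 0.00601 * π := by
    rw [hx, norm_mul, Complex.norm_real, Real.norm_eq_abs, ← hαℓ]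
    calc ‖betaJ c' D j‖ * |La| ≤ (3.005 * alpha D) * (0.002 * ℓP) :=
          mul_le_mul (hB j) hLaa (abs_nonneg _) (by positivity)
      _ = 0.00601 * (alpha D * ℓP) := by ring
  have hY : ‖y‖ ≤ 0.01202 * π + 0.000109 * π ^ 2 := by
    have e : y = (betaJ c' D (j + 1) + betaJ c' D (j + 2)) * (La : ℂ) +
        betaJ c' D (j + 1) * betaJ c' D (j + 2) / 2 * (La : ℂ) ^ 2 := by
      simp only [hy, fraky2, hLa]
    rw [e]
    have h1 : ‖(betaJ c' D (j + 1) + betaJ c' D (j + 2)) * (La : ℂ)‖ ≤ 0.01202 * π := by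
      rw [norm_mul, Complex.norm_real, Real.norm_eq_abs, ← hαℓ]
      calc ‖betaJ c' D (j + 1) + betaJ c' D (j + 2)‖ * |La|
          ≤ (3.005 * alpha D + 3.005 * alpha D) * (0.002 * ℓP) :=
            mul_le_mul ((norm_add_le _ _).trans (add_le_add (hB _) (hB _))) hLaa
              (abs_nonneg _) (by positivity)
        _ = 0.01202 * (alpha D * ℓP) := by ring
    have h2 : ‖betaJ c' D (j + 1) * betaJ c' D (j + 2) / 2 * (La : ℂ) ^ 2‖ ≤ 0.000109 * π ^ 2 := by
      rw [norm_mul, norm_div, norm_mul, Complex.norm_two, norm_pow, Complex.norm_real,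
        Real.norm_eq_abs]
      have hsq : |La| ^ 2 ≤ (0.002 * ℓP) ^ 2 := pow_le_pow_left₀ (abs_nonneg _) hLaa 2
      have hββ : ‖betaJ c' D (j + 1)‖ * ‖betaJ c' D (j + 2)‖ ≤ (3.005 * alpha D) * (3.005 * alpha D) :=
        mul_le_mul (hB _) (hB _) (norm_nonneg _) (by positivity)
      calc ‖betaJ c' D (j + 1)‖ * ‖betaJ c' D (j + 2)‖ / 2 * |La| ^ 2
          ≤ (3.005 * alpha D) * (3.005 * alpha D) / 2 * (0.002 * ℓP) ^ 2 :=
            mul_le_mul (div_le_div_of_nonneg_right hββ (by norm_num)) hsq (by positivity)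
              (by positivity)
        _ = 0.00001806005 * (alpha D * ℓP) ^ 2 := by ring
        _ ≤ 0.000109 * π ^ 2 := by rw [hαℓ]; nlinarith [Real.pi_pos]
    exact (norm_add_le _ _).trans (by linarith)
  have hnum : 0.00601 * π + (0.01202 * π + 0.000109 * π ^ 2) +
      0.00601 * π * (0.01202 * π + 0.000109 * π ^ 2) ≤ 0.065 := by
    nlinarith [Real.pi_lt_d2, Real.pi_pos, mul_pos Real.pi_pos Real.pi_pos]
  have := (norm_comb_le hX hY hnum).2
  have e : (1 - x) * (1 + y) - 1 = y - x - x * y := by ring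
  rw [e]; exact this

end Factors

/-! ### (S4) The crude bound `Re S_j(𝐚₂₃,𝐚₂₃) < 1100𝔞/log P` from the range evaluations -/

section Assembly

variable {D : ℕ} [NeZero D] (χ : DirichletCharacter ℂ D)

omit [NeZero D] in
/-- The weight `w(n) = |χ(n)|λ₀ⱼ(n)/φ(n)` is nearly positive: `Re w(n) ≥ 0.68 ‖w(n)‖` for
`1 ≤ n ≤ P`, `𝓛⁷ ≥ 16000(1 + 16|c′|)`. [cite: Zhang2022LandauSiegel, §18 p.100] -/
theorem re_weight_ge (hℓ : 16000 * (1 + 16 * |c'|) ≤ ell D ^ 7) (j : ℕ) {n : ℕ} (hn : 1 ≤ n)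
    (hnP : (n : ℝ) ≤ bigP D) :
    0.68 * ‖((‖χ (n : ZMod D)‖ : ℝ) : ℂ) * lamZero c' D j n / (Nat.totient n : ℂ)‖ ≤
      (((‖χ (n : ZMod D)‖ : ℝ) : ℂ) * lamZero c' D j n / (Nat.totient n : ℂ)).re := by
  have h := re_lamZero_ge c' hℓ j hn hnP
  have htot : 0 < (Nat.totient n : ℝ) := by exact_mod_cast Nat.totient_pos.mpr (by omega)
  have e : ((‖χ (n : ZMod D)‖ : ℝ) : ℂ) * lamZero c' D j n / (Nat.totient n : ℂ) =
      ((‖χ (n : ZMod D)‖ / Nat.totient n : ℝ) : ℂ) * lamZero c' D j n := by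
    push_cast; ring
  rw [e, norm_mul, Complex.norm_real, Real.norm_eq_abs, abs_of_nonneg (by positivity),
    Complex.re_ofReal_mul]
  have hc : 0 ≤ ‖χ (n : ZMod D)‖ / (Nat.totient n : ℝ) := by positivity
  nlinarith [norm_nonneg (lamZero c' D j n)]

omit [NeZero D] in
/-- Splitting the `[P^{0.5}, P^{0.504})` sum at `P^{0.502}`. [cite: Zhang2022LandauSiegel, §18 p.100] -/
private theorem sum_R23_split (f : ℕ → ℂ) :
    ∑ n ∈ (Finset.Ico 1 (Nsupp D)).filter
        (fun n : ℕ => bigP D ^ (0.5 : ℝ) ≤ (n : ℝ) ∧ (n : ℝ) < bigP D ^ (0.504 : ℝ)), f n =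
      ∑ n ∈ (Finset.Ico 1 (Nsupp D)).filter
          (fun n : ℕ => bigP D ^ (0.5 : ℝ) ≤ (n : ℝ) ∧ (n : ℝ) < bigP D ^ (0.502 : ℝ)), f n +
        ∑ n ∈ (Finset.Ico 1 (Nsupp D)).filter
          (fun n : ℕ => bigP D ^ (0.502 : ℝ) ≤ (n : ℝ) ∧ (n : ℝ) < bigP D ^ (0.504 : ℝ)), f n := by
  have hP1 : 1 ≤ bigP D := Real.one_le_exp (by rw [ell]; positivity)
  have h12 : bigP D ^ (0.5 : ℝ) ≤ bigP D ^ (0.502 : ℝ) :=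
    Real.rpow_le_rpow_of_exponent_le hP1 (by norm_num)
  have h23 : bigP D ^ (0.502 : ℝ) ≤ bigP D ^ (0.504 : ℝ) :=
    Real.rpow_le_rpow_of_exponent_le hP1 (by norm_num)
  rw [← Finset.sum_filter_add_sum_filter_not
    ((Finset.Ico 1 (Nsupp D)).filter
      (fun n : ℕ => bigP D ^ (0.5 : ℝ) ≤ (n : ℝ) ∧ (n : ℝ) < bigP D ^ (0.504 : ℝ)))
    (fun n : ℕ => (n : ℝ) < bigP D ^ (0.502 : ℝ))]
  congr 1
  · rw [Finset.filter_filter]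
    refine Finset.sum_congr (Finset.filter_congr fun n _ => ?_) fun _ _ => rfl
    constructor
    · rintro ⟨⟨h1, _⟩, h3⟩; exact ⟨h1, h3⟩
    · rintro ⟨h1, h3⟩; exact ⟨⟨h1, lt_of_lt_of_le h3 h23⟩, h3⟩
  · rw [Finset.filter_filter]
    refine Finset.sum_congr (Finset.filter_congr fun n _ => ?_) fun _ _ => rfl
    constructor
    · rintro ⟨⟨_, h2⟩, h3⟩; exact ⟨not_lt.mp h3, h2⟩
    · rintro ⟨h1, h2⟩; exact ⟨⟨h12.trans h1, h2⟩, not_lt.mpr h1⟩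

/-- **The "minor contribution" quantified**: for `D ≥ 3` with `𝓛⁷ ≥ 16000(1 + 16|c′|)` and `χ` real
primitive, the two displayed main terms of p. 100 (second and third range, reading `𝒴₂ⱼ` on the
third) exceed the simplified main term `(500L′/log P)²Σ_{P^{0.5} ≤ n < P^{0.504}}|χ(n)|λ₀ⱼ(n)/φ(n)`
by at most the factor `1 + 0.065/0.68` in real part: the factors `β_j log(n/P^{0.5})`,
`β_j log(P^{0.504}/n)`, `𝒴₁ⱼ(n)`, `𝒴₂ⱼ(n)` change each summand by `≤ 0.065|w(n)|`
(`factor_R2_le`, `factor_R3_le`) and `Re w(n) ≥ 0.68|w(n)|` (`re_weight_ge`).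
[cite: Zhang2022LandauSiegel, §18 p.100] -/
theorem re_main10_add_main11b_le (hD : 3 ≤ D) (hℓ : 16000 * (1 + 16 * |c'|) ≤ ell D ^ 7)
    (hq : χ.IsQuadratic) (hp : χ.IsPrimitive) (j : ℕ) :
    (main18u010 c' χ j + main18u011b c' χ j).re ≤ (1 + 0.065 / 0.68) * (main18u012 c' χ j).re := by
  -- names
  set R2 := (Finset.Ico 1 (Nsupp D)).filter
      (fun n : ℕ => bigP D ^ (0.5 : ℝ) ≤ (n : ℝ) ∧ (n : ℝ) < bigP D ^ (0.502 : ℝ)) with hR2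
  set R3 := (Finset.Ico 1 (Nsupp D)).filter
      (fun n : ℕ => bigP D ^ (0.502 : ℝ) ≤ (n : ℝ) ∧ (n : ℝ) < bigP D ^ (0.504 : ℝ)) with hR3
  set w : ℕ → ℂ := fun n => ((‖χ (n : ZMod D)‖ : ℝ) : ℂ) * lamZero c' D j n / (Nat.totient n : ℂ)
    with hw
  set g2 : ℕ → ℂ := fun n => (-1 - betaJ c' D j * (Real.log ((n : ℝ) / bigP D ^ (0.5 : ℝ)) : ℂ)) *
      (-1 + fraky1 c' D j n) - 1 with hg2
  set g3 : ℕ → ℂ := fun n => (1 - betaJ c' D j * (Real.log (bigP D ^ (0.504 : ℝ) / n) : ℂ)) *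
      (1 + fraky2 c' D j n) - 1 with hg3
  set p : ℝ := (500 * (deriv χ.LFunction 1).re / Real.log (bigP D)) ^ 2 with hpdef
  have hp0 : 0 ≤ p := sq_nonneg _
  have hpref := pref_sq_eq_ofReal χ hD hq hp
  -- the three main terms in terms of `w`, `g2`, `g3`
  have e10 : main18u010 c' χ j = (p : ℂ) * ∑ n ∈ R2, (w n + w n * g2 n) := by
    rw [main18u010, hpref]
    congr 1
    refine Finset.sum_congr rfl fun n _ => ?_
    simp only [hw, hg2]; ring
  have e11 : main18u011b c' χ j = (p : ℂ) * ∑ n ∈ R3, (w n + w n * g3 n) := by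
    rw [main18u011b, hpref]
    congr 1
    refine Finset.sum_congr rfl fun n _ => ?_
    simp only [hw, hg3]; ring
  have e12 : main18u012 c' χ j = (p : ℂ) * (∑ n ∈ R2, w n + ∑ n ∈ R3, w n) := by
    rw [main18u012, hpref, sum_R23_split]
  -- sizes of `n` in the ranges
  have hT1 : 1 ≤ bigT D := Real.one_le_exp (Real.rpow_nonneg (ell_nonneg D) _)
  have hNs : ∀ n ∈ Finset.Ico 1 (Nsupp D), 1 ≤ n ∧ (n : ℝ) ≤ bigP D := by
    intro n hn
    rw [Finset.mem_Ico] at hn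
    refine ⟨hn.1, ?_⟩
    have h1 : (n : ℝ) < bigP D / bigT D ^ 2 := Nat.lt_ceil.mp hn.2
    have h2 : bigP D / bigT D ^ 2 ≤ bigP D :=
      div_le_self (Real.exp_pos _).le (one_le_pow₀ hT1)
    linarith
  -- termwise bounds
  have hb2 : ∀ n ∈ R2, (w n * g2 n).re ≤ 0.065 / 0.68 * (w n).re := by
    intro n hn
    have hn' := Finset.mem_filter.mp hn
    obtain ⟨hn1, hnP⟩ := hNs n hn'.1
    have hg : ‖g2 n‖ ≤ 0.065 := factor_R2_le c' hD hℓ j hn'.2.1 hn'.2.2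
    have hwre := re_weight_ge c' χ hℓ j hn1 hnP
    calc (w n * g2 n).re ≤ ‖w n * g2 n‖ := Complex.re_le_norm _
      _ = ‖w n‖ * ‖g2 n‖ := norm_mul _ _
      _ ≤ ‖w n‖ * 0.065 := mul_le_mul_of_nonneg_left hg (norm_nonneg _)
      _ ≤ 0.065 / 0.68 * (w n).re := by nlinarith [norm_nonneg (w n)]
  have hb3 : ∀ n ∈ R3, (w n * g3 n).re ≤ 0.065 / 0.68 * (w n).re := by
    intro n hn
    have hn' := Finset.mem_filter.mp hn
    obtain ⟨hn1, hnP⟩ := hNs n hn'.1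
    have hg : ‖g3 n‖ ≤ 0.065 := factor_R3_le c' hD hℓ j hn'.2.1 hn'.2.2
    have hwre := re_weight_ge c' χ hℓ j hn1 hnP
    calc (w n * g3 n).re ≤ ‖w n * g3 n‖ := Complex.re_le_norm _
      _ = ‖w n‖ * ‖g3 n‖ := norm_mul _ _
      _ ≤ ‖w n‖ * 0.065 := mul_le_mul_of_nonneg_left hg (norm_nonneg _)
      _ ≤ 0.065 / 0.68 * (w n).re := by nlinarith [norm_nonneg (w n)]
  -- sum up
  rw [e10, e11, e12, ← mul_add, Complex.re_ofReal_mul, Complex.re_ofReal_mul, Complex.add_re,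
    Complex.add_re, Complex.re_sum, Complex.re_sum, Complex.re_sum, Complex.re_sum]
  have h2 : ∑ n ∈ R2, (w n + w n * g2 n).re ≤ (1 + 0.065 / 0.68) * ∑ n ∈ R2, (w n).re := by
    rw [Finset.mul_sum]
    refine Finset.sum_le_sum fun n hn => ?_
    rw [Complex.add_re]
    linarith [hb2 n hn]
  have h3 : ∑ n ∈ R3, (w n + w n * g3 n).re ≤ (1 + 0.065 / 0.68) * ∑ n ∈ R3, (w n).re := by
    rw [Finset.mul_sum]
    refine Finset.sum_le_sum fun n hn => ?_
    rw [Complex.add_re]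
    linarith [hb3 n hn]
  have := add_le_add h2 h3
  nlinarith [mul_le_mul_of_nonneg_left this hp0]

/-- A threshold `D₁(c′)` beyond which `D ≥ 3` and `𝓛⁷ ≥ 16000(1 + 16|c′|)`. [folklore] -/
private theorem exists_threshold : ∃ D₁ : ℕ, ∀ D : ℕ, D₁ ≤ D →
    3 ≤ D ∧ 16000 * (1 + 16 * |c'|) ≤ ell D ^ 7 := by
  set K : ℝ := 16000 * (1 + 16 * |c'|) with hK
  have hK0 : 0 ≤ K := by positivity
  refine ⟨⌈Real.exp (K ^ ((1:ℝ) / 7))⌉₊ + 3, fun D hD => ⟨by omega, ?_⟩⟩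
  have hD1 : Real.exp (K ^ ((1:ℝ) / 7)) ≤ D := by
    have := Nat.ceil_le.mp (show ⌈Real.exp (K ^ ((1:ℝ) / 7))⌉₊ ≤ D by omega)
    exact_mod_cast this
  have hlog : K ^ ((1:ℝ) / 7) ≤ ell D := by
    rw [ell, ← Real.log_exp (K ^ ((1:ℝ) / 7))]
    exact Real.log_le_log (Real.exp_pos _) hD1
  have hk0 : 0 ≤ K ^ ((1:ℝ) / 7) := Real.rpow_nonneg hK0 _
  calc K = (K ^ ((1:ℝ) / 7)) ^ 7 := by
        rw [← Real.rpow_natCast, ← Real.rpow_mul hK0]; norm_num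
    _ ≤ ell D ^ 7 := pow_le_pow_left₀ hk0 hlog 7

/-- **Kernel edge `Z22:§18.u013 ⇐ {u008, u009, the four range evaluations}`**: the crude bound
"`Re{S_j(𝐚₂₃,𝐚₂₃)} < 1100𝔞/log P`" (Z22 p.100, tex L4947–L4949) follows from the printed expansion
(u008), the three-range split (u009), "the sum over `dr < P^{0.5}` contributes `o(α)`", the two
range evaluations (u010; u011 in the reading `𝒴₂ⱼ` of (10.10)), and the major contribution
`1000𝔞/log P + o(α)` (u012): the manuscript's sentence "The factors … make minor contribution" is
quantified by `re_main10_add_main11b_le` (`≤ 9.6 %`), and the `o(α)` terms are absorbed using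
`𝔞 ≫ 1` (Lemma 5.7, `Skeleton.frakALowerBound_holds`) with `ε = a₀/4`:
`Re S_j ≤ (1095.6 + 3.3)𝔞/log P < 1100𝔞/log P`. DISCHARGE of an edge; its leaves are the typed
range claims. [cite: Zhang2022LandauSiegel, §18 p.100] -/
theorem step18_u013_of_ranges (h8 : Step18_u008 c') (h9 : Step18_u009 c') (hr1 : Step18_range1 c')
    (h10 : Step18_u010 c') (h11 : Step18_u011b c') (h12 : Step18_u012 c') : Step18_u013 c' := by
  obtain ⟨a₀, ha₀, ha⟩ := frakALowerBound_holds
  obtain ⟨D₁, hD₁⟩ := exists_threshold c'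
  set ε : ℝ := a₀ / 4 with hε
  have hε0 : 0 < ε := by positivity
  obtain ⟨D₀, hD₀⟩ :=
    (((((h8.and h9).and (hr1 ε hε0)).and (h10 ε hε0)).and (h11 ε hε0)).and (h12 ε hε0)).and ha
  refine ⟨max D₀ D₁, fun D _ χ hD hq hp hA j hj => ?_⟩
  obtain ⟨hD3, hℓ⟩ := hD₁ D (le_trans (le_max_right _ _) hD)
  obtain ⟨⟨⟨⟨⟨⟨e8, e9⟩, r1⟩, r10⟩, r11⟩, r12⟩, haa⟩ := hD₀ D χ (le_trans (le_max_left _ _) hD) hq hp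
  have hlogP : 0 < Real.log (bigP D) := by
    rw [log_bigP]; exact pow_pos (lt_trans one_pos (one_lt_ell hD3)) 9
  set ℓP := Real.log (bigP D) with hℓP
  have hαℓ : alpha D * ℓP = π := by
    rw [alpha, ← hℓP]; field_simp [hlogP.ne']
  have hα : alpha D = π / ℓP := by rw [alpha, ← hℓP]
  have haa' : a₀ ≤ frakA χ := haa hA
  have hfa : 0 < frakA χ := lt_of_lt_of_le ha₀ haa'
  -- the pieces at this `D, χ, j`
  have E8 := e8 j hj
  have E9 := e9 j hj
  have R1 := r1 hA j hj
  have R10 := r10 hA j hj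
  have R11 := r11 hA j hj
  have R12 := r12 hA j hj
  have key := re_main10_add_main11b_le c' χ hD3 hℓ hq hp j
  set S1 := Sj23Range c' χ j 0 (bigP D ^ (0.5 : ℝ))
  set S2 := Sj23Range c' χ j (bigP D ^ (0.5 : ℝ)) (bigP D ^ (0.502 : ℝ))
  set S3 := Sj23Range c' χ j (bigP D ^ (0.502 : ℝ)) (bigP D ^ (0.504 : ℝ))
  set m10 := main18u010 c' χ j
  set m11 := main18u011b c' χ j
  set m12 := main18u012 c' χ j
  rw [E8, E9, Complex.add_re, Complex.add_re]
  have b1 : S1.re ≤ ε * alpha D := (Complex.re_le_norm _).trans R1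
  have b2 : S2.re ≤ m10.re + ε * alpha D := by
    have := Complex.re_le_norm (S2 - m10); rw [Complex.sub_re] at this; linarith
  have b3 : S3.re ≤ m11.re + ε * alpha D := by
    have := Complex.re_le_norm (S3 - m11); rw [Complex.sub_re] at this; linarith
  have b12 : m12.re ≤ 1000 * frakA χ / ℓP + ε * alpha D := by
    have := Complex.re_le_norm (m12 - ((1000 * frakA χ / ℓP : ℝ) : ℂ))
    rw [Complex.sub_re, Complex.ofReal_re] at this; linarith
  have hm : m10.re + m11.re ≤ (1 + 0.065 / 0.68) * m12.re := by
    have := key; rwa [Complex.add_re] at this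
  -- numerics: everything over `ℓP`
  rw [hα] at b1 b2 b3 b12
  have hℓPpos := hlogP
  have goal : ε * (π / ℓP) + (m10.re + ε * (π / ℓP)) + (m11.re + ε * (π / ℓP)) <
      1100 * frakA χ / ℓP := by
    have h1 : m10.re + m11.re ≤ (1 + 0.065 / 0.68) * (1000 * frakA χ / ℓP + ε * (π / ℓP)) :=
      hm.trans (mul_le_mul_of_nonneg_left b12 (by norm_num))
    have h2 : (3 + (1 + 0.065 / 0.68)) * (ε * (π / ℓP)) + (1 + 0.065 / 0.68) * (1000 * frakA χ / ℓP) <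
        1100 * frakA χ / ℓP := by
      rw [hε]
      have hπ := Real.pi_lt_d2
      rw [show (3 + (1 + 0.065 / 0.68)) * (a₀ / 4 * (π / ℓP)) +
            (1 + 0.065 / 0.68) * (1000 * frakA χ / ℓP) =
          ((3 + (1 + 0.065 / 0.68)) * (a₀ / 4) * π + (1 + 0.065 / 0.68) * 1000 * frakA χ) / ℓP
          by ring]
      rw [div_lt_div_iff_of_pos_right hℓPpos]
      nlinarith [mul_le_mul_of_nonneg_right haa' Real.pi_pos.le]
    linarith
  linarith

end Assembly

/-! ### The two-sided companion: `|S_j(𝐚₂₃,𝐚₂₃)| ≪ (𝔞 + 1)/log P` (the size Prop. 7.1's error term needs) -/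

section TwoSided

variable {D : ℕ} [NeZero D] (χ : DirichletCharacter ℂ D)

/-- Norm version of `re_main10_add_main11b_le`: `‖main₁₀‖ + ‖main₁₁‖ ≤ (1.065/0.68)·Re main₁₂`.
[cite: Zhang2022LandauSiegel, §18 p.100] -/
theorem norm_main10_add_main11b_le (hD : 3 ≤ D) (hℓ : 16000 * (1 + 16 * |c'|) ≤ ell D ^ 7)
    (hq : χ.IsQuadratic) (hp : χ.IsPrimitive) (j : ℕ) :
    ‖main18u010 c' χ j‖ + ‖main18u011b c' χ j‖ ≤ (1.065 / 0.68) * (main18u012 c' χ j).re := by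
  set R2 := (Finset.Ico 1 (Nsupp D)).filter
      (fun n : ℕ => bigP D ^ (0.5 : ℝ) ≤ (n : ℝ) ∧ (n : ℝ) < bigP D ^ (0.502 : ℝ)) with hR2
  set R3 := (Finset.Ico 1 (Nsupp D)).filter
      (fun n : ℕ => bigP D ^ (0.502 : ℝ) ≤ (n : ℝ) ∧ (n : ℝ) < bigP D ^ (0.504 : ℝ)) with hR3
  set w : ℕ → ℂ := fun n => ((‖χ (n : ZMod D)‖ : ℝ) : ℂ) * lamZero c' D j n / (Nat.totient n : ℂ)
    with hw
  set g2 : ℕ → ℂ := fun n => (-1 - betaJ c' D j * (Real.log ((n : ℝ) / bigP D ^ (0.5 : ℝ)) : ℂ)) *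
      (-1 + fraky1 c' D j n) - 1 with hg2
  set g3 : ℕ → ℂ := fun n => (1 - betaJ c' D j * (Real.log (bigP D ^ (0.504 : ℝ) / n) : ℂ)) *
      (1 + fraky2 c' D j n) - 1 with hg3
  set p : ℝ := (500 * (deriv χ.LFunction 1).re / Real.log (bigP D)) ^ 2 with hpdef
  have hp0 : 0 ≤ p := sq_nonneg _
  have hpref := pref_sq_eq_ofReal χ hD hq hp
  have e10 : main18u010 c' χ j = (p : ℂ) * ∑ n ∈ R2, (w n + w n * g2 n) := by
    rw [main18u010, hpref]
    congr 1
    refine Finset.sum_congr rfl fun n _ => ?_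
    simp only [hw, hg2]; ring
  have e11 : main18u011b c' χ j = (p : ℂ) * ∑ n ∈ R3, (w n + w n * g3 n) := by
    rw [main18u011b, hpref]
    congr 1
    refine Finset.sum_congr rfl fun n _ => ?_
    simp only [hw, hg3]; ring
  have e12 : main18u012 c' χ j = (p : ℂ) * (∑ n ∈ R2, w n + ∑ n ∈ R3, w n) := by
    rw [main18u012, hpref, sum_R23_split]
  have hT1 : 1 ≤ bigT D := Real.one_le_exp (Real.rpow_nonneg (ell_nonneg D) _)
  have hNs : ∀ n ∈ Finset.Ico 1 (Nsupp D), 1 ≤ n ∧ (n : ℝ) ≤ bigP D := by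
    intro n hn
    rw [Finset.mem_Ico] at hn
    refine ⟨hn.1, ?_⟩
    have h1 : (n : ℝ) < bigP D / bigT D ^ 2 := Nat.lt_ceil.mp hn.2
    have h2 : bigP D / bigT D ^ 2 ≤ bigP D :=
      div_le_self (Real.exp_pos _).le (one_le_pow₀ hT1)
    linarith
  have hb2 : ∀ n ∈ R2, ‖w n + w n * g2 n‖ ≤ 1.065 / 0.68 * (w n).re := by
    intro n hn
    have hn' := Finset.mem_filter.mp hn
    obtain ⟨hn1, hnP⟩ := hNs n hn'.1
    have hg : ‖g2 n‖ ≤ 0.065 := factor_R2_le c' hD hℓ j hn'.2.1 hn'.2.2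
    have hwre := re_weight_ge c' χ hℓ j hn1 hnP
    calc ‖w n + w n * g2 n‖ ≤ ‖w n‖ + ‖w n * g2 n‖ := norm_add_le _ _
      _ = ‖w n‖ + ‖w n‖ * ‖g2 n‖ := by rw [norm_mul]
      _ ≤ ‖w n‖ + ‖w n‖ * 0.065 := by nlinarith [norm_nonneg (w n)]
      _ ≤ 1.065 / 0.68 * (w n).re := by nlinarith [norm_nonneg (w n)]
  have hb3 : ∀ n ∈ R3, ‖w n + w n * g3 n‖ ≤ 1.065 / 0.68 * (w n).re := by
    intro n hn
    have hn' := Finset.mem_filter.mp hn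
    obtain ⟨hn1, hnP⟩ := hNs n hn'.1
    have hg : ‖g3 n‖ ≤ 0.065 := factor_R3_le c' hD hℓ j hn'.2.1 hn'.2.2
    have hwre := re_weight_ge c' χ hℓ j hn1 hnP
    calc ‖w n + w n * g3 n‖ ≤ ‖w n‖ + ‖w n * g3 n‖ := norm_add_le _ _
      _ = ‖w n‖ + ‖w n‖ * ‖g3 n‖ := by rw [norm_mul]
      _ ≤ ‖w n‖ + ‖w n‖ * 0.065 := by nlinarith [norm_nonneg (w n)]
      _ ≤ 1.065 / 0.68 * (w n).re := by nlinarith [norm_nonneg (w n)]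
  have hpn : ‖(p : ℂ)‖ = p := by rw [Complex.norm_real, Real.norm_eq_abs, abs_of_nonneg hp0]
  rw [e10, e11, e12, norm_mul, norm_mul, hpn, Complex.re_ofReal_mul, Complex.add_re,
    Complex.re_sum, Complex.re_sum]
  have h2 : ‖∑ n ∈ R2, (w n + w n * g2 n)‖ ≤ 1.065 / 0.68 * ∑ n ∈ R2, (w n).re := by
    rw [Finset.mul_sum]
    exact (norm_sum_le _ _).trans (Finset.sum_le_sum hb2)
  have h3 : ‖∑ n ∈ R3, (w n + w n * g3 n)‖ ≤ 1.065 / 0.68 * ∑ n ∈ R3, (w n).re := by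
    rw [Finset.mul_sum]
    exact (norm_sum_le _ _).trans (Finset.sum_le_sum hb3)
  have := add_le_add (mul_le_mul_of_nonneg_left h2 hp0) (mul_le_mul_of_nonneg_left h3 hp0)
  nlinarith

/-- **The two-sided size of `S_j(𝐚₂₃,𝐚₂₃)`** from the same range evaluations:
`|S_j(𝐚₂₃,𝐚₂₃)| ≤ 1600(𝔞 + 1)/log P` eventually, `1 ≤ j ≤ 3` — the bound Proposition 7.1's error
term `E(𝐚₂₃,𝐚₂₃) = 𝔓𝓛²Σ_j|S_j|` needs in the deduction of (2.33) (not displayed in print; here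
derived from the displayed range claims with `ε = 1`). [cite: Zhang2022LandauSiegel, §18 p.100] -/
theorem sjNorm_of_ranges (h8 : Step18_u008 c') (h9 : Step18_u009 c') (hr1 : Step18_range1 c')
    (h10 : Step18_u010 c') (h11 : Step18_u011b c') (h12 : Step18_u012 c') :
    ∃ C : ℝ, ForAllLarge fun D _ χ => AssumptionA D χ → ∀ j ∈ ({1, 2, 3} : Finset ℕ),
      ‖Sj c' D j (a23 χ) (a23 χ)‖ ≤ C * (frakA χ + 1) / Real.log (bigP D) := by
  obtain ⟨D₁, hD₁⟩ := exists_threshold c'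
  obtain ⟨D₀, hD₀⟩ :=
    ((((h8.and h9).and (hr1 1 one_pos)).and (h10 1 one_pos)).and (h11 1 one_pos)).and (h12 1 one_pos)
  refine ⟨1600, max D₀ D₁, fun D _ χ hD hq hp hA j hj => ?_⟩
  obtain ⟨hD3, hℓ⟩ := hD₁ D (le_trans (le_max_right _ _) hD)
  obtain ⟨⟨⟨⟨⟨e8, e9⟩, r1⟩, r10⟩, r11⟩, r12⟩ := hD₀ D χ (le_trans (le_max_left _ _) hD) hq hp
  have hlogP : 0 < Real.log (bigP D) := by
    rw [log_bigP]; exact pow_pos (lt_trans one_pos (one_lt_ell hD3)) 9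
  set ℓP := Real.log (bigP D) with hℓP
  have hα : alpha D = π / ℓP := by rw [alpha, ← hℓP]
  have hfa : 0 ≤ frakA χ := frakA_nonneg χ
  have E8 := e8 j hj
  have E9 := e9 j hj
  have R1 := r1 hA j hj
  have R10 := r10 hA j hj
  have R11 := r11 hA j hj
  have R12 := r12 hA j hj
  have key := norm_main10_add_main11b_le c' χ hD3 hℓ hq hp j
  set S1 := Sj23Range c' χ j 0 (bigP D ^ (0.5 : ℝ))
  set S2 := Sj23Range c' χ j (bigP D ^ (0.5 : ℝ)) (bigP D ^ (0.502 : ℝ))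
  set S3 := Sj23Range c' χ j (bigP D ^ (0.502 : ℝ)) (bigP D ^ (0.504 : ℝ))
  set m10 := main18u010 c' χ j
  set m11 := main18u011b c' χ j
  set m12 := main18u012 c' χ j
  rw [E8, E9]
  have b2 : ‖S2‖ ≤ ‖m10‖ + 1 * alpha D := by
    have := norm_sub_norm_le S2 m10; linarith
  have b3 : ‖S3‖ ≤ ‖m11‖ + 1 * alpha D := by
    have := norm_sub_norm_le S3 m11; linarith
  have b12 : m12.re ≤ 1000 * frakA χ / ℓP + 1 * alpha D := by
    have := Complex.re_le_norm (m12 - ((1000 * frakA χ / ℓP : ℝ) : ℂ))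
    rw [Complex.sub_re, Complex.ofReal_re] at this; linarith
  have htri : ‖S1 + S2 + S3‖ ≤ ‖S1‖ + ‖S2‖ + ‖S3‖ :=
    (norm_add_le _ _).trans (by linarith [norm_add_le S1 S2])
  rw [hα] at b2 b3 b12 R1
  have hπ := Real.pi_lt_d2
  have hsum : ‖S1‖ + ‖S2‖ + ‖S3‖ ≤
      3 * (π / ℓP) + (1.065 / 0.68) * (1000 * frakA χ / ℓP + 1 * (π / ℓP)) := by
    nlinarith [norm_nonneg m10, norm_nonneg m11]
  have hfin : 3 * (π / ℓP) + (1.065 / 0.68) * (1000 * frakA χ / ℓP + 1 * (π / ℓP)) ≤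
      1600 * (frakA χ + 1) / ℓP := by
    rw [show 3 * (π / ℓP) + (1.065 / 0.68) * (1000 * frakA χ / ℓP + 1 * (π / ℓP)) =
        (3 * π + (1.065 / 0.68) * (1000 * frakA χ + π)) / ℓP by ring]
    exact div_le_div_of_nonneg_right (by nlinarith) hlogP.le
  linarith

end TwoSided


/-! ### The printed third-range display (`𝒴₁ⱼ`, `Step18_u011`): factor modulus `≤ 0.1`, and the
two-sided size of `S_j(𝐚₂₃,𝐚₂₃)` from the PRINTED range claims -/

section Printed

variable {D : ℕ} [NeZero D] (χ : DirichletCharacter ℂ D)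

omit [NeZero D] χ in
/-- **The third-range factor AS PRINTED (with `𝒴₁ⱼ`) is within `0.1` of `1`**: for
`P^{0.502} ≤ n < P^{0.504}` and `𝓛⁷ ≥ 16000(1 + 16|c′|)`,
`‖(1 − β_j log(P^{0.504}/n))(1 + 𝒴₁ⱼ(n)) − 1‖ ≤ 0.1` (here `log(n/P^{0.5}) ∈ [0.002, 0.004) log P`,
so `|𝒴₁ⱼ(n)| ≤ 0.0763`). [cite: Zhang2022LandauSiegel, §18 p.100; §10 (10.9)] -/
theorem factor_R3_printed_le (hD : 3 ≤ D) (hℓ : 16000 * (1 + 16 * |c'|) ≤ ell D ^ 7) (j : ℕ)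
    {n : ℕ} (hn1 : bigP D ^ (0.502 : ℝ) ≤ (n : ℝ)) (hn2 : (n : ℝ) < bigP D ^ (0.504 : ℝ)) :
    ‖(1 - betaJ c' D j * (Real.log (bigP D ^ (0.504 : ℝ) / n) : ℂ)) *
          (1 + fraky1 c' D j n) - 1‖ ≤ 0.1 := by
  have hlogP : 0 < Real.log (bigP D) := by
    rw [log_bigP]; exact pow_pos (lt_trans one_pos (one_lt_ell hD)) 9
  set ℓP := Real.log (bigP D) with hℓP
  have hαℓ : alpha D * ℓP = π := by
    rw [alpha, ← hℓP]; field_simp [hlogP.ne']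
  have hP1 : 1 ≤ bigP D := Real.one_le_exp (by rw [ell]; positivity)
  have h12 : bigP D ^ (0.5 : ℝ) ≤ bigP D ^ (0.502 : ℝ) :=
    Real.rpow_le_rpow_of_exponent_le hP1 (by norm_num)
  have hn0 : 0 < (n : ℝ) := lt_of_lt_of_le (Ppow_pos D _) hn1
  set L1 := Real.log ((n : ℝ) / bigP D ^ (0.5 : ℝ)) with hL1
  set La := Real.log (bigP D ^ (0.504 : ℝ) / n) with hLa
  set Lb := Real.log (bigP D ^ (0.502 : ℝ) / n) with hLb
  have hlogn1 : 0.502 * ℓP ≤ Real.log n := by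
    rw [← log_Ppow]; exact Real.log_le_log (Ppow_pos D _) hn1
  have hlogn2 : Real.log n < 0.504 * ℓP := by
    rw [← log_Ppow]; exact Real.log_lt_log hn0 hn2
  have eL1 : L1 = Real.log n - 0.5 * ℓP := by
    rw [hL1, Real.log_div hn0.ne' (Ppow_pos D _).ne', log_Ppow]
  have eLa : La = 0.504 * ℓP - Real.log n := by
    rw [hLa, Real.log_div (Ppow_pos D _).ne' hn0.ne', log_Ppow]
  have eLb : Lb = 0.502 * ℓP - Real.log n := by
    rw [hLb, Real.log_div (Ppow_pos D _).ne' hn0.ne', log_Ppow]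
  have hL1a : |L1| ≤ 0.004 * ℓP := by rw [eL1, abs_le]; constructor <;> linarith
  have hLaa : |La| ≤ 0.002 * ℓP := by rw [eLa, abs_le]; constructor <;> linarith
  have hLba : |Lb| ≤ 0.002 * ℓP := by rw [eLb, abs_le]; constructor <;> linarith
  have hB := norm_betaJ_le c' hℓ
  have hα0 : 0 ≤ alpha D := alpha_nonneg D
  set x : ℂ := betaJ c' D j * (La : ℂ) with hx
  set y : ℂ := fraky1 c' D j n with hy
  have hX : ‖x‖ ≤ 0.00601 * π := by
    rw [hx, norm_mul, Complex.norm_real, Real.norm_eq_abs, ← hαℓ]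
    calc ‖betaJ c' D j‖ * |La| ≤ (3.005 * alpha D) * (0.002 * ℓP) :=
          mul_le_mul (hB j) hLaa (abs_nonneg _) (by positivity)
      _ = 0.00601 * (alpha D * ℓP) := by ring
  have hY : ‖y‖ ≤ 0.02404 * π + 0.000055 * π ^ 2 := by
    have e : y = (betaJ c' D (j + 1) + betaJ c' D (j + 2)) * (L1 : ℂ) +
        betaJ c' D (j + 1) * betaJ c' D (j + 2) / 2 * ((La : ℂ) ^ 2 - 2 * (Lb : ℂ) ^ 2) := by
      simp only [hy, fraky1, hL1, hLa, hLb]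
    rw [e]
    have h1 : ‖(betaJ c' D (j + 1) + betaJ c' D (j + 2)) * (L1 : ℂ)‖ ≤ 0.02404 * π := by
      rw [norm_mul, Complex.norm_real, Real.norm_eq_abs, ← hαℓ]
      calc ‖betaJ c' D (j + 1) + betaJ c' D (j + 2)‖ * |L1|
          ≤ (3.005 * alpha D + 3.005 * alpha D) * (0.004 * ℓP) :=
            mul_le_mul ((norm_add_le _ _).trans (add_le_add (hB _) (hB _))) hL1a
              (abs_nonneg _) (by positivity)
        _ = 0.02404 * (alpha D * ℓP) := by ring
    have h2 : ‖betaJ c' D (j + 1) * betaJ c' D (j + 2) / 2 * ((La : ℂ) ^ 2 - 2 * (Lb : ℂ) ^ 2)‖ ≤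
        0.000055 * π ^ 2 := by
      rw [norm_mul, norm_div, norm_mul, Complex.norm_two]
      have hsq : ‖(La : ℂ) ^ 2 - 2 * (Lb : ℂ) ^ 2‖ ≤ 0.000012 * ℓP ^ 2 := by
        calc ‖(La : ℂ) ^ 2 - 2 * (Lb : ℂ) ^ 2‖ ≤ ‖(La : ℂ) ^ 2‖ + ‖2 * (Lb : ℂ) ^ 2‖ := norm_sub_le _ _
          _ = La ^ 2 + 2 * Lb ^ 2 := by
              rw [norm_pow, norm_mul, norm_pow, Complex.norm_real, Complex.norm_real,
                Complex.norm_two, Real.norm_eq_abs, Real.norm_eq_abs, sq_abs, sq_abs]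
          _ ≤ (0.002 * ℓP) ^ 2 + 2 * (0.002 * ℓP) ^ 2 := by
              have ha : La ^ 2 ≤ (0.002 * ℓP) ^ 2 := by
                rw [← sq_abs La]; exact pow_le_pow_left₀ (abs_nonneg _) hLaa 2
              have hb : Lb ^ 2 ≤ (0.002 * ℓP) ^ 2 := by
                rw [← sq_abs Lb]; exact pow_le_pow_left₀ (abs_nonneg _) hLba 2
              linarith
          _ = 0.000012 * ℓP ^ 2 := by ring
      have hββ : ‖betaJ c' D (j + 1)‖ * ‖betaJ c' D (j + 2)‖ ≤ (3.005 * alpha D) * (3.005 * alpha D) :=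
        mul_le_mul (hB _) (hB _) (norm_nonneg _) (by positivity)
      calc ‖betaJ c' D (j + 1)‖ * ‖betaJ c' D (j + 2)‖ / 2 * ‖(La : ℂ) ^ 2 - 2 * (Lb : ℂ) ^ 2‖
          ≤ (3.005 * alpha D) * (3.005 * alpha D) / 2 * (0.000012 * ℓP ^ 2) :=
            mul_le_mul (div_le_div_of_nonneg_right hββ (by norm_num)) hsq (norm_nonneg _)
              (by positivity)
        _ = 0.00005418015 * (alpha D * ℓP) ^ 2 := by ring
        _ ≤ 0.000055 * π ^ 2 := by rw [hαℓ]; nlinarith [Real.pi_pos]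
    exact (norm_add_le _ _).trans (by linarith)
  have hnum : 0.00601 * π + (0.02404 * π + 0.000055 * π ^ 2) +
      0.00601 * π * (0.02404 * π + 0.000055 * π ^ 2) ≤ 0.1 := by
    nlinarith [Real.pi_lt_d2, Real.pi_pos, mul_pos Real.pi_pos Real.pi_pos]
  have := (norm_comb_le hX hY hnum).2
  have e : (1 - x) * (1 + y) - 1 = y - x - x * y := by ring
  rw [e]; exact this

/-- Norm bound with the PRINTED third-range main term `main18u011` (`𝒴₁ⱼ`):
`‖main₁₀‖ + ‖main₁₁‖ ≤ (1.1/0.68)·Re main₁₂`. [cite: Zhang2022LandauSiegel, §18 p.100] -/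
theorem norm_main10_add_main11_le (hD : 3 ≤ D) (hℓ : 16000 * (1 + 16 * |c'|) ≤ ell D ^ 7)
    (hq : χ.IsQuadratic) (hp : χ.IsPrimitive) (j : ℕ) :
    ‖main18u010 c' χ j‖ + ‖main18u011 c' χ j‖ ≤ (1.1 / 0.68) * (main18u012 c' χ j).re := by
  set R2 := (Finset.Ico 1 (Nsupp D)).filter
      (fun n : ℕ => bigP D ^ (0.5 : ℝ) ≤ (n : ℝ) ∧ (n : ℝ) < bigP D ^ (0.502 : ℝ)) with hR2
  set R3 := (Finset.Ico 1 (Nsupp D)).filter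
      (fun n : ℕ => bigP D ^ (0.502 : ℝ) ≤ (n : ℝ) ∧ (n : ℝ) < bigP D ^ (0.504 : ℝ)) with hR3
  set w : ℕ → ℂ := fun n => ((‖χ (n : ZMod D)‖ : ℝ) : ℂ) * lamZero c' D j n / (Nat.totient n : ℂ)
    with hw
  set g2 : ℕ → ℂ := fun n => (-1 - betaJ c' D j * (Real.log ((n : ℝ) / bigP D ^ (0.5 : ℝ)) : ℂ)) *
      (-1 + fraky1 c' D j n) - 1 with hg2
  set g3 : ℕ → ℂ := fun n => (1 - betaJ c' D j * (Real.log (bigP D ^ (0.504 : ℝ) / n) : ℂ)) *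
      (1 + fraky1 c' D j n) - 1 with hg3
  set p : ℝ := (500 * (deriv χ.LFunction 1).re / Real.log (bigP D)) ^ 2 with hpdef
  have hp0 : 0 ≤ p := sq_nonneg _
  have hpref := pref_sq_eq_ofReal χ hD hq hp
  have e10 : main18u010 c' χ j = (p : ℂ) * ∑ n ∈ R2, (w n + w n * g2 n) := by
    rw [main18u010, hpref]
    congr 1
    refine Finset.sum_congr rfl fun n _ => ?_
    simp only [hw, hg2]; ring
  have e11 : main18u011 c' χ j = (p : ℂ) * ∑ n ∈ R3, (w n + w n * g3 n) := by
    rw [main18u011, hpref]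
    congr 1
    refine Finset.sum_congr rfl fun n _ => ?_
    simp only [hw, hg3]; ring
  have e12 : main18u012 c' χ j = (p : ℂ) * (∑ n ∈ R2, w n + ∑ n ∈ R3, w n) := by
    rw [main18u012, hpref, sum_R23_split]
  have hT1 : 1 ≤ bigT D := Real.one_le_exp (Real.rpow_nonneg (ell_nonneg D) _)
  have hNs : ∀ n ∈ Finset.Ico 1 (Nsupp D), 1 ≤ n ∧ (n : ℝ) ≤ bigP D := by
    intro n hn
    rw [Finset.mem_Ico] at hn
    refine ⟨hn.1, ?_⟩
    have h1 : (n : ℝ) < bigP D / bigT D ^ 2 := Nat.lt_ceil.mp hn.2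
    have h2 : bigP D / bigT D ^ 2 ≤ bigP D :=
      div_le_self (Real.exp_pos _).le (one_le_pow₀ hT1)
    linarith
  have hb2 : ∀ n ∈ R2, ‖w n + w n * g2 n‖ ≤ 1.1 / 0.68 * (w n).re := by
    intro n hn
    have hn' := Finset.mem_filter.mp hn
    obtain ⟨hn1, hnP⟩ := hNs n hn'.1
    have hg : ‖g2 n‖ ≤ 0.065 := factor_R2_le c' hD hℓ j hn'.2.1 hn'.2.2
    have hwre := re_weight_ge c' χ hℓ j hn1 hnP
    calc ‖w n + w n * g2 n‖ ≤ ‖w n‖ + ‖w n * g2 n‖ := norm_add_le _ _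
      _ = ‖w n‖ + ‖w n‖ * ‖g2 n‖ := by rw [norm_mul]
      _ ≤ ‖w n‖ + ‖w n‖ * 0.1 := by nlinarith [norm_nonneg (w n)]
      _ ≤ 1.1 / 0.68 * (w n).re := by nlinarith [norm_nonneg (w n)]
  have hb3 : ∀ n ∈ R3, ‖w n + w n * g3 n‖ ≤ 1.1 / 0.68 * (w n).re := by
    intro n hn
    have hn' := Finset.mem_filter.mp hn
    obtain ⟨hn1, hnP⟩ := hNs n hn'.1
    have hg : ‖g3 n‖ ≤ 0.1 := factor_R3_printed_le c' hD hℓ j hn'.2.1 hn'.2.2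
    have hwre := re_weight_ge c' χ hℓ j hn1 hnP
    calc ‖w n + w n * g3 n‖ ≤ ‖w n‖ + ‖w n * g3 n‖ := norm_add_le _ _
      _ = ‖w n‖ + ‖w n‖ * ‖g3 n‖ := by rw [norm_mul]
      _ ≤ ‖w n‖ + ‖w n‖ * 0.1 := by nlinarith [norm_nonneg (w n)]
      _ ≤ 1.1 / 0.68 * (w n).re := by nlinarith [norm_nonneg (w n)]
  have hpn : ‖(p : ℂ)‖ = p := by rw [Complex.norm_real, Real.norm_eq_abs, abs_of_nonneg hp0]
  rw [e10, e11, e12, norm_mul, norm_mul, hpn, Complex.re_ofReal_mul, Complex.add_re,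
    Complex.re_sum, Complex.re_sum]
  have h2 : ‖∑ n ∈ R2, (w n + w n * g2 n)‖ ≤ 1.1 / 0.68 * ∑ n ∈ R2, (w n).re := by
    rw [Finset.mul_sum]
    exact (norm_sum_le _ _).trans (Finset.sum_le_sum hb2)
  have h3 : ‖∑ n ∈ R3, (w n + w n * g3 n)‖ ≤ 1.1 / 0.68 * ∑ n ∈ R3, (w n).re := by
    rw [Finset.mul_sum]
    exact (norm_sum_le _ _).trans (Finset.sum_le_sum hb3)
  have := add_le_add (mul_le_mul_of_nonneg_left h2 hp0) (mul_le_mul_of_nonneg_left h3 hp0)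
  nlinarith

/-- **The two-sided size of `S_j(𝐚₂₃,𝐚₂₃)` from the PRINTED range claims** (third range with
`𝒴₁ⱼ`, `Step18_u011`): `|S_j(𝐚₂₃,𝐚₂₃)| ≤ 1700(𝔞 + 1)/log P` eventually, `1 ≤ j ≤ 3`.
[cite: Zhang2022LandauSiegel, §18 p.100] -/
theorem sjNorm_of_ranges_printed (h8 : Step18_u008 c') (h9 : Step18_u009 c')
    (hr1 : Step18_range1 c') (h10 : Step18_u010 c') (h11 : Step18_u011 c')
    (h12 : Step18_u012 c') :
    ∃ C : ℝ, ForAllLarge fun D _ χ => AssumptionA D χ → ∀ j ∈ ({1, 2, 3} : Finset ℕ),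
      ‖Sj c' D j (a23 χ) (a23 χ)‖ ≤ C * (frakA χ + 1) / Real.log (bigP D) := by
  obtain ⟨D₁, hD₁⟩ := exists_threshold c'
  obtain ⟨D₀, hD₀⟩ :=
    ((((h8.and h9).and (hr1 1 one_pos)).and (h10 1 one_pos)).and (h11 1 one_pos)).and (h12 1 one_pos)
  refine ⟨1700, max D₀ D₁, fun D _ χ hD hq hp hA j hj => ?_⟩
  obtain ⟨hD3, hℓ⟩ := hD₁ D (le_trans (le_max_right _ _) hD)
  obtain ⟨⟨⟨⟨⟨e8, e9⟩, r1⟩, r10⟩, r11⟩, r12⟩ := hD₀ D χ (le_trans (le_max_left _ _) hD) hq hp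
  have hlogP : 0 < Real.log (bigP D) := by
    rw [log_bigP]; exact pow_pos (lt_trans one_pos (one_lt_ell hD3)) 9
  set ℓP := Real.log (bigP D) with hℓP
  have hα : alpha D = π / ℓP := by rw [alpha, ← hℓP]
  have hfa : 0 ≤ frakA χ := frakA_nonneg χ
  have E8 := e8 j hj
  have E9 := e9 j hj
  have R1 := r1 hA j hj
  have R10 := r10 hA j hj
  have R11 := r11 hA j hj
  have R12 := r12 hA j hj
  have key := norm_main10_add_main11_le c' χ hD3 hℓ hq hp j
  set S1 := Sj23Range c' χ j 0 (bigP D ^ (0.5 : ℝ))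
  set S2 := Sj23Range c' χ j (bigP D ^ (0.5 : ℝ)) (bigP D ^ (0.502 : ℝ))
  set S3 := Sj23Range c' χ j (bigP D ^ (0.502 : ℝ)) (bigP D ^ (0.504 : ℝ))
  set m10 := main18u010 c' χ j
  set m11 := main18u011 c' χ j
  set m12 := main18u012 c' χ j
  rw [E8, E9]
  have b2 : ‖S2‖ ≤ ‖m10‖ + 1 * alpha D := by
    have := norm_sub_norm_le S2 m10; linarith
  have b3 : ‖S3‖ ≤ ‖m11‖ + 1 * alpha D := by
    have := norm_sub_norm_le S3 m11; linarith
  have b12 : m12.re ≤ 1000 * frakA χ / ℓP + 1 * alpha D := by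
    have := Complex.re_le_norm (m12 - ((1000 * frakA χ / ℓP : ℝ) : ℂ))
    rw [Complex.sub_re, Complex.ofReal_re] at this; linarith
  have htri : ‖S1 + S2 + S3‖ ≤ ‖S1‖ + ‖S2‖ + ‖S3‖ :=
    (norm_add_le _ _).trans (by linarith [norm_add_le S1 S2])
  rw [hα] at b2 b3 b12 R1
  have hπ := Real.pi_lt_d2
  have hsum : ‖S1‖ + ‖S2‖ + ‖S3‖ ≤
      3 * (π / ℓP) + (1.1 / 0.68) * (1000 * frakA χ / ℓP + 1 * (π / ℓP)) := by
    nlinarith [norm_nonneg m10, norm_nonneg m11]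
  have hfin : 3 * (π / ℓP) + (1.1 / 0.68) * (1000 * frakA χ / ℓP + 1 * (π / ℓP)) ≤
      1700 * (frakA χ + 1) / ℓP := by
    rw [show 3 * (π / ℓP) + (1.1 / 0.68) * (1000 * frakA χ / ℓP + 1 * (π / ℓP)) =
        (3 * π + (1.1 / 0.68) * (1000 * frakA χ + π)) / ℓP by ring]
    exact div_le_div_of_nonneg_right (by nlinarith) hlogP.le
  linarith

end Printed


/-! ### The leaf `Skeleton.Ded183` from the range claims -/

section Closing

/-- **The leaf `Skeleton.Ded183 c′` (cone C27) from the six range-level nodes** (`𝒴₂ⱼ` reading of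
the third range): `Step18_u008 → Step18_u009 → Step18_range1 → Step18_u010 → Step18_u011b →
Step18_u012 → Skeleton.Ded183 c′`, composing `step18_u013_of_ranges`, `sjNorm_of_ranges` and
sz-d56's `Sec18Ded183.ded183_of_crude`. The remaining leaves are the four displayed range
evaluations of p. 100 ("By the discussion in Section 8 and 10").
[cite: Zhang2022LandauSiegel, §18 p.100] -/
theorem ded183_of_ranges (h8 : Step18_u008 c') (h9 : Step18_u009 c') (hr1 : Step18_range1 c')
    (h10 : Step18_u010 c') (h11 : Step18_u011b c') (h12 : Step18_u012 c') : Skeleton.Ded183 c' :=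
  Sec18Ded183.ded183_of_crude c' (step18_u013_of_ranges c' h8 h9 hr1 h10 h11 h12)
    (sjNorm_of_ranges c' h8 h9 hr1 h10 h11 h12)

/-- The leaf `Skeleton.Ded183 c′` from the PRINTED range displays (`Step18_u011`, `𝒴₁ⱼ`) together
with the printed crude bound `Step18_u013` (whose derivation by modulus bookkeeping is done above
only in the `𝒴₂ⱼ` reading): `… → Step18_u011 → Step18_u012 → Step18_u013 → Skeleton.Ded183 c′`.
[cite: Zhang2022LandauSiegel, §18 p.100] -/
theorem ded183_of_ranges_printed (h8 : Step18_u008 c') (h9 : Step18_u009 c')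
    (hr1 : Step18_range1 c') (h10 : Step18_u010 c') (h11 : Step18_u011 c') (h12 : Step18_u012 c')
    (h13 : Step18_u013 c') : Skeleton.Ded183 c' :=
  Sec18Ded183.ded183_of_crude c' h13 (sjNorm_of_ranges_printed c' h8 h9 hr1 h10 h11 h12)

end Closing


/-! ### The crude bound with the PRINTED third-range display (`𝒴₁ⱼ`): the real-part refinement

With `β_k = ib_k` purely imaginary, the first-order parts of the "minor" factors are purely
imaginary, so the REAL part of `(−1 − β_jL₁)(−1 + 𝒴₁ⱼ) − 1` (and of the printed third-range factor)
is second order, `≤ 0.002`; and once `𝓛⁷ ≥ 610000(1 + 16|c′|)` the weight `w(n) = |χ(n)|λ₀ⱼ(n)/φ(n)`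
has `|Im w| ≤ 0.02|w|`. Hence `Re(w·g) ≤ 0.004|w|` termwise and the crude bound follows with the
printed `𝒴₁ⱼ` as well (indeed with room: `Re S_j ≤ 1008𝔞/log P`). -/

section PrintedCrude

variable {D : ℕ}

/-- The angle bound with a general threshold `K ≥ 16000`: `𝓛⁷ ≥ K(1 + 16|c′|)` gives
`14·M·Σ_{q∣n} log q/q ≤ 3822π/K`. [folklore] -/
private theorem angle_le_of_K {K : ℝ} (hK : 16000 ≤ K) (hℓ : K * (1 + 16 * |c'|) ≤ ell D ^ 7)
    {S : ℝ} (hS0 : 0 ≤ S) (hS : S ≤ Real.log (ell D ^ 9) * (1 + Real.log (ell D ^ 9)) + 1) :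
    14 * (3 * alpha D * (1 + 5 * |c'| * alpha D * ell D)) * S ≤ 3822 * π / K := by
  set L := ell D with hL
  have hK0 : 0 < K := by linarith
  have hKc : 0 < 1 + 16 * |c'| := by positivity
  have hL2 : 2 ≤ L := by
    by_contra h
    push Not at h
    have hL0 : 0 ≤ L := ell_nonneg D
    have h7 : L ^ 7 < 2 ^ 7 := by gcongr
    have h16 : (16000 : ℝ) ≤ K * (1 + 16 * |c'|) := by nlinarith [abs_nonneg c']
    norm_num at h7
    linarith
  have hL1 : 1 ≤ L := by linarith
  have hLpos : 0 < L := by linarith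
  have hα : alpha D = π / L ^ 9 := by rw [alpha, log_bigP]
  have hlogL : Real.log L ≤ L := (Real.log_le_sub_one_of_pos hLpos).trans (by linarith)
  have hlogL0 : 0 ≤ Real.log L := Real.log_nonneg hL1
  have hlog9 : Real.log (L ^ 9) = 9 * Real.log L := by
    rw [Real.log_pow]; norm_num
  have hS' : S ≤ 91 * L ^ 2 := by
    rw [hlog9] at hS
    nlinarith
  have hαL : alpha D * L ≤ 1 := by
    rw [hα, div_mul_eq_mul_div, div_le_one (by positivity)]
    have : L ^ 8 * L = L ^ 9 := by ring
    have h8 : (2:ℝ) ^ 8 ≤ L ^ 8 := by gcongr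
    nlinarith [Real.pi_lt_d2]
  have hM : 3 * alpha D * (1 + 5 * |c'| * alpha D * ell D) ≤ 3 * (π / L ^ 9) * (1 + 16 * |c'|) := by
    rw [← hL, hα] at *
    have hc : 0 ≤ |c'| := abs_nonneg _
    have h1 : 5 * |c'| * (π / L ^ 9) * L ≤ 16 * |c'| := by
      have := mul_le_mul_of_nonneg_left hαL (by positivity : (0:ℝ) ≤ 5 * |c'|)
      rw [hα] at this
      nlinarith
    have hπL : 0 ≤ π / L ^ 9 := by positivity
    nlinarith
  calc 14 * (3 * alpha D * (1 + 5 * |c'| * alpha D * ell D)) * S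
      ≤ 14 * (3 * (π / L ^ 9) * (1 + 16 * |c'|)) * (91 * L ^ 2) :=
        mul_le_mul (mul_le_mul_of_nonneg_left hM (by norm_num)) hS' hS0 (by positivity)
    _ = 3822 * π * (1 + 16 * |c'|) / L ^ 7 := by
        field_simp
        ring
    _ ≤ 3822 * π * (1 + 16 * |c'|) / (K * (1 + 16 * |c'|)) := by
        apply div_le_div_of_nonneg_left (by positivity) (by positivity) hℓ
    _ = 3822 * π / K := by field_simp

/-- **Small angle**: for `𝓛⁷ ≥ 610000(1 + 16|c′|)` and `1 ≤ n ≤ P`, `λ₀ⱼ(n) = |λ₀ⱼ(n)|e^{iΦ}` with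
`|Φ| ≤ 0.02`; hence `|Im λ₀ⱼ(n)| ≤ 0.02|λ₀ⱼ(n)|` and `Re λ₀ⱼ(n) ≥ 0.9998|λ₀ⱼ(n)|`.
[cite: Zhang2022LandauSiegel, §7 p. 33] -/
theorem lamZero_im_re_of_ell (hℓ : 610000 * (1 + 16 * |c'|) ≤ ell D ^ 7) (j : ℕ) {n : ℕ}
    (hn : 1 ≤ n) (hnP : (n : ℝ) ≤ bigP D) :
    |(lamZero c' D j n).im| ≤ 0.02 * ‖lamZero c' D j n‖ ∧
      0.9998 * ‖lamZero c' D j n‖ ≤ (lamZero c' D j n).re := by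
  obtain ⟨Φ, hΦ, hpol⟩ := lamZero_polar c' D j n
  have hL2 : 2 ≤ ell D := by
    by_contra h
    push Not at h
    have hL0 : 0 ≤ ell D := ell_nonneg D
    have h7 : ell D ^ 7 < 2 ^ 7 := by gcongr
    have h16 : (610000 : ℝ) ≤ 610000 * (1 + 16 * |c'|) := by nlinarith [abs_nonneg c']
    norm_num at h7
    linarith
  have hy : Real.exp 1 ≤ ell D ^ 9 := by
    have h1 : Real.exp 1 < 3 := lt_trans Real.exp_one_lt_d9 (by norm_num)
    have h2 : (2:ℝ) ^ 9 ≤ ell D ^ 9 := by gcongr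
    linarith
  have hlogn : Real.log n ≤ ell D ^ 9 := by
    rw [← log_bigP]
    exact Real.log_le_log (by exact_mod_cast hn) hnP
  have hS := sum_primeFactors_log_div_le hn hy hlogn
  have hS0 : 0 ≤ ∑ q ∈ n.primeFactors, Real.log q / q :=
    Finset.sum_nonneg fun q hq => div_nonneg
      (Real.log_nonneg (by exact_mod_cast (Nat.prime_of_mem_primeFactors hq).one_le)) (by positivity)
  have hΦ' : |Φ| ≤ 0.02 := by
    have h := hΦ.trans (angle_le_of_K c' (by norm_num) hℓ hS0 hS)
    have : 3822 * π / 610000 ≤ 0.02 := by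
      rw [div_le_iff₀ (by norm_num)]; nlinarith [Real.pi_lt_d2]
    linarith
  have hre : (lamZero c' D j n).re = ‖lamZero c' D j n‖ * Real.cos Φ := by
    conv_lhs => rw [hpol]
    rw [Complex.re_ofReal_mul, Complex.exp_ofReal_mul_I_re]
  have him : (lamZero c' D j n).im = ‖lamZero c' D j n‖ * Real.sin Φ := by
    conv_lhs => rw [hpol]
    rw [Complex.im_ofReal_mul, Complex.exp_ofReal_mul_I_im]
  have hN := norm_nonneg (lamZero c' D j n)
  constructor
  · rw [him, abs_mul, abs_of_nonneg hN]
    have hsin : |Real.sin Φ| ≤ 0.02 := (Real.abs_sin_le_abs).trans hΦ'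
    nlinarith [abs_nonneg (Real.sin Φ)]
  · have hcos : 0.9998 ≤ Real.cos Φ := by
      have h1 := Real.one_sub_sq_div_two_le_cos (x := Φ)
      have h2 : Φ ^ 2 ≤ 0.02 ^ 2 := by
        rw [← sq_abs]; exact pow_le_pow_left₀ (abs_nonneg _) hΦ' 2
      nlinarith
    rw [hre]
    nlinarith

variable [NeZero D] (χ : DirichletCharacter ℂ D)

omit [NeZero D] in
/-- The weight `w(n) = |χ(n)|λ₀ⱼ(n)/φ(n)` under the stronger threshold: `|Im w| ≤ 0.02|w|`,
`Re w ≥ 0.9998|w|`. [cite: Zhang2022LandauSiegel, §18 p.100] -/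
theorem weight_im_re (hℓ : 610000 * (1 + 16 * |c'|) ≤ ell D ^ 7) (j : ℕ) {n : ℕ} (hn : 1 ≤ n)
    (hnP : (n : ℝ) ≤ bigP D) :
    |(((‖χ (n : ZMod D)‖ : ℝ) : ℂ) * lamZero c' D j n / (Nat.totient n : ℂ)).im| ≤
        0.02 * ‖((‖χ (n : ZMod D)‖ : ℝ) : ℂ) * lamZero c' D j n / (Nat.totient n : ℂ)‖ ∧
      0.9998 * ‖((‖χ (n : ZMod D)‖ : ℝ) : ℂ) * lamZero c' D j n / (Nat.totient n : ℂ)‖ ≤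
        (((‖χ (n : ZMod D)‖ : ℝ) : ℂ) * lamZero c' D j n / (Nat.totient n : ℂ)).re := by
  obtain ⟨him, hre⟩ := lamZero_im_re_of_ell c' hℓ j hn hnP
  have htot : 0 < (Nat.totient n : ℝ) := by exact_mod_cast Nat.totient_pos.mpr (by omega)
  have e : ((‖χ (n : ZMod D)‖ : ℝ) : ℂ) * lamZero c' D j n / (Nat.totient n : ℂ) =
      ((‖χ (n : ZMod D)‖ / Nat.totient n : ℝ) : ℂ) * lamZero c' D j n := by
    push_cast; ring
  have hc : 0 ≤ ‖χ (n : ZMod D)‖ / (Nat.totient n : ℝ) := by positivity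
  rw [e, norm_mul, Complex.norm_real, Real.norm_eq_abs, abs_of_nonneg hc,
    Complex.re_ofReal_mul, Complex.im_ofReal_mul, abs_mul, abs_of_nonneg hc]
  have hN := norm_nonneg (lamZero c' D j n)
  constructor
  · nlinarith
  · nlinarith

omit [NeZero D] χ in
/-- `Re(β_k·L) = 0` for real `L` (the shifts are purely imaginary). [cite: Zhang2022LandauSiegel, §2 (2.13)] -/
theorem re_betaJ_mul_ofReal (k : ℕ) (L : ℝ) : (betaJ c' D k * (L : ℂ)).re = 0 := by
  obtain ⟨b, hb, _⟩ := betaJ_eq_real_mul_I c' D k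
  rw [hb]; simp

omit [NeZero D] χ in
/-- Generic real-part bookkeeping: if `Re x = 0` and `y = y₁ + y₂` with `Re y₁ = 0`, then
`|Re(x − y − xy)|, |Re(y − x − xy)| ≤ ‖y₂‖ + ‖x‖‖y‖`. [folklore] -/
private theorem abs_re_comb_le {x y y1 y2 : ℂ} (hx : x.re = 0) (hy : y = y1 + y2) (hy1 : y1.re = 0) :
    |(x - y - x * y).re| ≤ ‖y2‖ + ‖x‖ * ‖y‖ ∧ |(y - x - x * y).re| ≤ ‖y2‖ + ‖x‖ * ‖y‖ := by
  have hyre : |y.re| ≤ ‖y2‖ := by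
    rw [hy, Complex.add_re, hy1, zero_add]
    exact (Complex.abs_re_le_norm y2)
  have hxy : |(x * y).re| ≤ ‖x‖ * ‖y‖ := (Complex.abs_re_le_norm _).trans (norm_mul_le _ _)
  constructor
  · rw [Complex.sub_re, Complex.sub_re, hx]
    calc |0 - y.re - (x * y).re| = |-(y.re + (x * y).re)| := by ring_nf
      _ ≤ |y.re| + |(x * y).re| := by rw [abs_neg]; exact abs_add_le _ _
      _ ≤ ‖y2‖ + ‖x‖ * ‖y‖ := add_le_add hyre hxy
  · rw [Complex.sub_re, Complex.sub_re, hx, sub_zero]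
    calc |y.re - (x * y).re| ≤ |y.re| + |(x * y).re| := abs_sub _ _
      _ ≤ ‖y2‖ + ‖x‖ * ‖y‖ := add_le_add hyre hxy

omit [NeZero D] χ in
/-- Second-range factor, real part: `|Re((−1 − β_jL₁)(−1 + 𝒴₁ⱼ(n)) − 1)| ≤ 0.002` on
`P^{0.5} ≤ n < P^{0.502}` (`𝓛⁷ ≥ 16000(1 + 16|c′|)`). [cite: Zhang2022LandauSiegel, §18 p.100; §10 (10.9)] -/
theorem factor_R2_re_le (hD : 3 ≤ D) (hℓ : 16000 * (1 + 16 * |c'|) ≤ ell D ^ 7) (j : ℕ) {n : ℕ}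
    (hn1 : bigP D ^ (0.5 : ℝ) ≤ (n : ℝ)) (hn2 : (n : ℝ) < bigP D ^ (0.502 : ℝ)) :
    |((-1 - betaJ c' D j * (Real.log ((n : ℝ) / bigP D ^ (0.5 : ℝ)) : ℂ)) *
          (-1 + fraky1 c' D j n) - 1).re| ≤ 0.002 := by
  have hlogP : 0 < Real.log (bigP D) := by
    rw [log_bigP]; exact pow_pos (lt_trans one_pos (one_lt_ell hD)) 9
  set ℓP := Real.log (bigP D) with hℓP
  have hαℓ : alpha D * ℓP = π := by
    rw [alpha, ← hℓP]; field_simp [hlogP.ne']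
  have hn0 : 0 < (n : ℝ) := lt_of_lt_of_le (Ppow_pos D _) hn1
  set L1 := Real.log ((n : ℝ) / bigP D ^ (0.5 : ℝ)) with hL1
  set La := Real.log (bigP D ^ (0.504 : ℝ) / n) with hLa
  set Lb := Real.log (bigP D ^ (0.502 : ℝ) / n) with hLb
  have hlogn1 : 0.5 * ℓP ≤ Real.log n := by
    rw [← log_Ppow]; exact Real.log_le_log (Ppow_pos D _) hn1
  have hlogn2 : Real.log n < 0.502 * ℓP := by
    rw [← log_Ppow]; exact Real.log_lt_log hn0 hn2
  have eL1 : L1 = Real.log n - 0.5 * ℓP := by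
    rw [hL1, Real.log_div hn0.ne' (Ppow_pos D _).ne', log_Ppow]
  have eLa : La = 0.504 * ℓP - Real.log n := by
    rw [hLa, Real.log_div (Ppow_pos D _).ne' hn0.ne', log_Ppow]
  have eLb : Lb = 0.502 * ℓP - Real.log n := by
    rw [hLb, Real.log_div (Ppow_pos D _).ne' hn0.ne', log_Ppow]
  have hL1a : |L1| ≤ 0.002 * ℓP := by rw [eL1, abs_le]; constructor <;> linarith
  have hLaa : |La| ≤ 0.004 * ℓP := by rw [eLa, abs_le]; constructor <;> linarith
  have hLba : |Lb| ≤ 0.002 * ℓP := by rw [eLb, abs_le]; constructor <;> linarith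
  have hB := norm_betaJ_le c' hℓ
  have hα0 : 0 ≤ alpha D := alpha_nonneg D
  set x : ℂ := betaJ c' D j * (L1 : ℂ) with hx
  set y : ℂ := fraky1 c' D j n with hy
  set y1 : ℂ := (betaJ c' D (j + 1) + betaJ c' D (j + 2)) * (L1 : ℂ) with hy1
  set y2 : ℂ := betaJ c' D (j + 1) * betaJ c' D (j + 2) / 2 * ((La : ℂ) ^ 2 - 2 * (Lb : ℂ) ^ 2)
    with hy2
  have e : y = y1 + y2 := by simp only [hy, hy1, hy2, fraky1, hL1, hLa, hLb]
  have hxre : x.re = 0 := re_betaJ_mul_ofReal c' j L1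
  have hy1re : y1.re = 0 := by
    rw [hy1, add_mul, Complex.add_re, re_betaJ_mul_ofReal, re_betaJ_mul_ofReal, add_zero]
  have hX : ‖x‖ ≤ 0.00601 * π := by
    rw [hx, norm_mul, Complex.norm_real, Real.norm_eq_abs, ← hαℓ]
    calc ‖betaJ c' D j‖ * |L1| ≤ (3.005 * alpha D) * (0.002 * ℓP) :=
          mul_le_mul (hB j) hL1a (abs_nonneg _) (by positivity)
      _ = 0.00601 * (alpha D * ℓP) := by ring
  have h1 : ‖y1‖ ≤ 0.01202 * π := by
    rw [hy1, norm_mul, Complex.norm_real, Real.norm_eq_abs, ← hαℓ]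
    calc ‖betaJ c' D (j + 1) + betaJ c' D (j + 2)‖ * |L1|
        ≤ (3.005 * alpha D + 3.005 * alpha D) * (0.002 * ℓP) :=
          mul_le_mul ((norm_add_le _ _).trans (add_le_add (hB _) (hB _))) hL1a
            (abs_nonneg _) (by positivity)
      _ = 0.01202 * (alpha D * ℓP) := by ring
  have h2 : ‖y2‖ ≤ 0.000109 * π ^ 2 := by
    rw [hy2, norm_mul, norm_div, norm_mul, Complex.norm_two]
    have hsq : ‖(La : ℂ) ^ 2 - 2 * (Lb : ℂ) ^ 2‖ ≤ 0.000024 * ℓP ^ 2 := by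
      calc ‖(La : ℂ) ^ 2 - 2 * (Lb : ℂ) ^ 2‖ ≤ ‖(La : ℂ) ^ 2‖ + ‖2 * (Lb : ℂ) ^ 2‖ := norm_sub_le _ _
        _ = La ^ 2 + 2 * Lb ^ 2 := by
            rw [norm_pow, norm_mul, norm_pow, Complex.norm_real, Complex.norm_real,
              Complex.norm_two, Real.norm_eq_abs, Real.norm_eq_abs, sq_abs, sq_abs]
        _ ≤ (0.004 * ℓP) ^ 2 + 2 * (0.002 * ℓP) ^ 2 := by
            have ha : La ^ 2 ≤ (0.004 * ℓP) ^ 2 := by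
              rw [← sq_abs La]; exact pow_le_pow_left₀ (abs_nonneg _) hLaa 2
            have hb : Lb ^ 2 ≤ (0.002 * ℓP) ^ 2 := by
              rw [← sq_abs Lb]; exact pow_le_pow_left₀ (abs_nonneg _) hLba 2
            linarith
        _ = 0.000024 * ℓP ^ 2 := by ring
    have hββ : ‖betaJ c' D (j + 1)‖ * ‖betaJ c' D (j + 2)‖ ≤ (3.005 * alpha D) * (3.005 * alpha D) :=
      mul_le_mul (hB _) (hB _) (norm_nonneg _) (by positivity)
    calc ‖betaJ c' D (j + 1)‖ * ‖betaJ c' D (j + 2)‖ / 2 * ‖(La : ℂ) ^ 2 - 2 * (Lb : ℂ) ^ 2‖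
        ≤ (3.005 * alpha D) * (3.005 * alpha D) / 2 * (0.000024 * ℓP ^ 2) :=
          mul_le_mul (div_le_div_of_nonneg_right hββ (by norm_num)) hsq (norm_nonneg _)
            (by positivity)
      _ = 0.0001083603 * (alpha D * ℓP) ^ 2 := by ring
      _ ≤ 0.000109 * π ^ 2 := by rw [hαℓ]; nlinarith [Real.pi_pos]
  have hY : ‖y‖ ≤ 0.01202 * π + 0.000109 * π ^ 2 := by
    rw [e]; exact (norm_add_le _ _).trans (by linarith)
  have key := (abs_re_comb_le hxre e hy1re).1
  have hnum : 0.000109 * π ^ 2 + 0.00601 * π * (0.01202 * π + 0.000109 * π ^ 2) ≤ 0.002 := by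
    nlinarith [Real.pi_lt_d2, Real.pi_pos, mul_pos Real.pi_pos Real.pi_pos]
  have hprod : ‖x‖ * ‖y‖ ≤ 0.00601 * π * (0.01202 * π + 0.000109 * π ^ 2) :=
    mul_le_mul hX hY (norm_nonneg _) (by positivity)
  have e2 : (-1 - x) * (-1 + y) - 1 = x - y - x * y := by ring
  rw [e2]
  linarith

omit [NeZero D] χ in
/-- Third-range factor AS PRINTED (`𝒴₁ⱼ`), real part: `|Re((1 − β_jL₂)(1 + 𝒴₁ⱼ(n)) − 1)| ≤ 0.002`
on `P^{0.502} ≤ n < P^{0.504}` (`𝓛⁷ ≥ 16000(1 + 16|c′|)`). [cite: Zhang2022LandauSiegel, §18 p.100; §10 (10.9)] -/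
theorem factor_R3_printed_re_le (hD : 3 ≤ D) (hℓ : 16000 * (1 + 16 * |c'|) ≤ ell D ^ 7) (j : ℕ)
    {n : ℕ} (hn1 : bigP D ^ (0.502 : ℝ) ≤ (n : ℝ)) (hn2 : (n : ℝ) < bigP D ^ (0.504 : ℝ)) :
    |((1 - betaJ c' D j * (Real.log (bigP D ^ (0.504 : ℝ) / n) : ℂ)) *
          (1 + fraky1 c' D j n) - 1).re| ≤ 0.002 := by
  have hlogP : 0 < Real.log (bigP D) := by
    rw [log_bigP]; exact pow_pos (lt_trans one_pos (one_lt_ell hD)) 9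
  set ℓP := Real.log (bigP D) with hℓP
  have hαℓ : alpha D * ℓP = π := by
    rw [alpha, ← hℓP]; field_simp [hlogP.ne']
  have hn0 : 0 < (n : ℝ) := lt_of_lt_of_le (Ppow_pos D _) hn1
  set L1 := Real.log ((n : ℝ) / bigP D ^ (0.5 : ℝ)) with hL1
  set La := Real.log (bigP D ^ (0.504 : ℝ) / n) with hLa
  set Lb := Real.log (bigP D ^ (0.502 : ℝ) / n) with hLb
  have hlogn1 : 0.502 * ℓP ≤ Real.log n := by
    rw [← log_Ppow]; exact Real.log_le_log (Ppow_pos D _) hn1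
  have hlogn2 : Real.log n < 0.504 * ℓP := by
    rw [← log_Ppow]; exact Real.log_lt_log hn0 hn2
  have eL1 : L1 = Real.log n - 0.5 * ℓP := by
    rw [hL1, Real.log_div hn0.ne' (Ppow_pos D _).ne', log_Ppow]
  have eLa : La = 0.504 * ℓP - Real.log n := by
    rw [hLa, Real.log_div (Ppow_pos D _).ne' hn0.ne', log_Ppow]
  have eLb : Lb = 0.502 * ℓP - Real.log n := by
    rw [hLb, Real.log_div (Ppow_pos D _).ne' hn0.ne', log_Ppow]
  have hL1a : |L1| ≤ 0.004 * ℓP := by rw [eL1, abs_le]; constructor <;> linarith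
  have hLaa : |La| ≤ 0.002 * ℓP := by rw [eLa, abs_le]; constructor <;> linarith
  have hLba : |Lb| ≤ 0.002 * ℓP := by rw [eLb, abs_le]; constructor <;> linarith
  have hB := norm_betaJ_le c' hℓ
  have hα0 : 0 ≤ alpha D := alpha_nonneg D
  set x : ℂ := betaJ c' D j * (La : ℂ) with hx
  set y : ℂ := fraky1 c' D j n with hy
  set y1 : ℂ := (betaJ c' D (j + 1) + betaJ c' D (j + 2)) * (L1 : ℂ) with hy1
  set y2 : ℂ := betaJ c' D (j + 1) * betaJ c' D (j + 2) / 2 * ((La : ℂ) ^ 2 - 2 * (Lb : ℂ) ^ 2)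
    with hy2
  have e : y = y1 + y2 := by simp only [hy, hy1, hy2, fraky1, hL1, hLa, hLb]
  have hxre : x.re = 0 := re_betaJ_mul_ofReal c' j La
  have hy1re : y1.re = 0 := by
    rw [hy1, add_mul, Complex.add_re, re_betaJ_mul_ofReal, re_betaJ_mul_ofReal, add_zero]
  have hX : ‖x‖ ≤ 0.00601 * π := by
    rw [hx, norm_mul, Complex.norm_real, Real.norm_eq_abs, ← hαℓ]
    calc ‖betaJ c' D j‖ * |La| ≤ (3.005 * alpha D) * (0.002 * ℓP) :=
          mul_le_mul (hB j) hLaa (abs_nonneg _) (by positivity)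
      _ = 0.00601 * (alpha D * ℓP) := by ring
  have h1 : ‖y1‖ ≤ 0.02404 * π := by
    rw [hy1, norm_mul, Complex.norm_real, Real.norm_eq_abs, ← hαℓ]
    calc ‖betaJ c' D (j + 1) + betaJ c' D (j + 2)‖ * |L1|
        ≤ (3.005 * alpha D + 3.005 * alpha D) * (0.004 * ℓP) :=
          mul_le_mul ((norm_add_le _ _).trans (add_le_add (hB _) (hB _))) hL1a
            (abs_nonneg _) (by positivity)
      _ = 0.02404 * (alpha D * ℓP) := by ring
  have h2 : ‖y2‖ ≤ 0.000055 * π ^ 2 := by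
    rw [hy2, norm_mul, norm_div, norm_mul, Complex.norm_two]
    have hsq : ‖(La : ℂ) ^ 2 - 2 * (Lb : ℂ) ^ 2‖ ≤ 0.000012 * ℓP ^ 2 := by
      calc ‖(La : ℂ) ^ 2 - 2 * (Lb : ℂ) ^ 2‖ ≤ ‖(La : ℂ) ^ 2‖ + ‖2 * (Lb : ℂ) ^ 2‖ := norm_sub_le _ _
        _ = La ^ 2 + 2 * Lb ^ 2 := by
            rw [norm_pow, norm_mul, norm_pow, Complex.norm_real, Complex.norm_real,
              Complex.norm_two, Real.norm_eq_abs, Real.norm_eq_abs, sq_abs, sq_abs]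
        _ ≤ (0.002 * ℓP) ^ 2 + 2 * (0.002 * ℓP) ^ 2 := by
            have ha : La ^ 2 ≤ (0.002 * ℓP) ^ 2 := by
              rw [← sq_abs La]; exact pow_le_pow_left₀ (abs_nonneg _) hLaa 2
            have hb : Lb ^ 2 ≤ (0.002 * ℓP) ^ 2 := by
              rw [← sq_abs Lb]; exact pow_le_pow_left₀ (abs_nonneg _) hLba 2
            linarith
        _ = 0.000012 * ℓP ^ 2 := by ring
    have hββ : ‖betaJ c' D (j + 1)‖ * ‖betaJ c' D (j + 2)‖ ≤ (3.005 * alpha D) * (3.005 * alpha D) :=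
      mul_le_mul (hB _) (hB _) (norm_nonneg _) (by positivity)
    calc ‖betaJ c' D (j + 1)‖ * ‖betaJ c' D (j + 2)‖ / 2 * ‖(La : ℂ) ^ 2 - 2 * (Lb : ℂ) ^ 2‖
        ≤ (3.005 * alpha D) * (3.005 * alpha D) / 2 * (0.000012 * ℓP ^ 2) :=
          mul_le_mul (div_le_div_of_nonneg_right hββ (by norm_num)) hsq (norm_nonneg _)
            (by positivity)
      _ = 0.00005418015 * (alpha D * ℓP) ^ 2 := by ring
      _ ≤ 0.000055 * π ^ 2 := by rw [hαℓ]; nlinarith [Real.pi_pos]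
  have hY : ‖y‖ ≤ 0.02404 * π + 0.000055 * π ^ 2 := by
    rw [e]; exact (norm_add_le _ _).trans (by linarith)
  have key := (abs_re_comb_le hxre e hy1re).2
  have hnum : 0.000055 * π ^ 2 + 0.00601 * π * (0.02404 * π + 0.000055 * π ^ 2) ≤ 0.002 := by
    nlinarith [Real.pi_lt_d2, Real.pi_pos, mul_pos Real.pi_pos Real.pi_pos]
  have hprod : ‖x‖ * ‖y‖ ≤ 0.00601 * π * (0.02404 * π + 0.000055 * π ^ 2) :=
    mul_le_mul hX hY (norm_nonneg _) (by positivity)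
  have e2 : (1 - x) * (1 + y) - 1 = y - x - x * y := by ring
  rw [e2]
  linarith

/-- **Real-part version of the "minor contribution" bound with the PRINTED `𝒴₁ⱼ`**: for `D ≥ 3`,
`𝓛⁷ ≥ 610000(1 + 16|c′|)`, `χ` real primitive:
`Re(main₁₀ + main₁₁) ≤ (1 + 0.004/0.9998)·Re(main₁₂)` — termwise
`Re(w·g) = Re w·Re g − Im w·Im g ≤ |w|(0.002 + 0.02·0.1)` and `Re w ≥ 0.9998|w|`.
[cite: Zhang2022LandauSiegel, §18 p.100] -/
theorem re_main10_add_main11_le (hD : 3 ≤ D) (hℓ : 610000 * (1 + 16 * |c'|) ≤ ell D ^ 7)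
    (hq : χ.IsQuadratic) (hp : χ.IsPrimitive) (j : ℕ) :
    (main18u010 c' χ j + main18u011 c' χ j).re ≤ (1 + 0.004 / 0.9998) * (main18u012 c' χ j).re := by
  have hℓ16 : 16000 * (1 + 16 * |c'|) ≤ ell D ^ 7 := by
    have : (0:ℝ) ≤ 1 + 16 * |c'| := by positivity
    nlinarith
  set R2 := (Finset.Ico 1 (Nsupp D)).filter
      (fun n : ℕ => bigP D ^ (0.5 : ℝ) ≤ (n : ℝ) ∧ (n : ℝ) < bigP D ^ (0.502 : ℝ)) with hR2
  set R3 := (Finset.Ico 1 (Nsupp D)).filter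
      (fun n : ℕ => bigP D ^ (0.502 : ℝ) ≤ (n : ℝ) ∧ (n : ℝ) < bigP D ^ (0.504 : ℝ)) with hR3
  set w : ℕ → ℂ := fun n => ((‖χ (n : ZMod D)‖ : ℝ) : ℂ) * lamZero c' D j n / (Nat.totient n : ℂ)
    with hw
  set g2 : ℕ → ℂ := fun n => (-1 - betaJ c' D j * (Real.log ((n : ℝ) / bigP D ^ (0.5 : ℝ)) : ℂ)) *
      (-1 + fraky1 c' D j n) - 1 with hg2
  set g3 : ℕ → ℂ := fun n => (1 - betaJ c' D j * (Real.log (bigP D ^ (0.504 : ℝ) / n) : ℂ)) *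
      (1 + fraky1 c' D j n) - 1 with hg3
  set p : ℝ := (500 * (deriv χ.LFunction 1).re / Real.log (bigP D)) ^ 2 with hpdef
  have hp0 : 0 ≤ p := sq_nonneg _
  have hpref := pref_sq_eq_ofReal χ hD hq hp
  have e10 : main18u010 c' χ j = (p : ℂ) * ∑ n ∈ R2, (w n + w n * g2 n) := by
    rw [main18u010, hpref]
    congr 1
    refine Finset.sum_congr rfl fun n _ => ?_
    simp only [hw, hg2]; ring
  have e11 : main18u011 c' χ j = (p : ℂ) * ∑ n ∈ R3, (w n + w n * g3 n) := by
    rw [main18u011, hpref]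
    congr 1
    refine Finset.sum_congr rfl fun n _ => ?_
    simp only [hw, hg3]; ring
  have e12 : main18u012 c' χ j = (p : ℂ) * (∑ n ∈ R2, w n + ∑ n ∈ R3, w n) := by
    rw [main18u012, hpref, sum_R23_split]
  have hT1 : 1 ≤ bigT D := Real.one_le_exp (Real.rpow_nonneg (ell_nonneg D) _)
  have hNs : ∀ n ∈ Finset.Ico 1 (Nsupp D), 1 ≤ n ∧ (n : ℝ) ≤ bigP D := by
    intro n hn
    rw [Finset.mem_Ico] at hn
    refine ⟨hn.1, ?_⟩
    have h1 : (n : ℝ) < bigP D / bigT D ^ 2 := Nat.lt_ceil.mp hn.2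
    have h2 : bigP D / bigT D ^ 2 ≤ bigP D :=
      div_le_self (Real.exp_pos _).le (one_le_pow₀ hT1)
    linarith
  -- termwise: `Re(w g) = Re w Re g − Im w Im g ≤ |w|(|Re g| + 0.02‖g‖)`
  have hterm : ∀ (v g : ℂ), |v.im| ≤ 0.02 * ‖v‖ → |g.re| ≤ 0.002 → ‖g‖ ≤ 0.1 →
      (v * g).re ≤ 0.004 * ‖v‖ := by
    intro v g hv hgr hgn
    rw [Complex.mul_re]
    have h1 : v.re * g.re ≤ ‖v‖ * 0.002 := by
      have := Complex.abs_re_le_norm v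
      nlinarith [abs_nonneg v.re, abs_nonneg g.re, abs_mul_abs_self v.re,
        abs_le.mp this, abs_le.mp hgr, norm_nonneg v, mul_le_mul this hgr (abs_nonneg _) (norm_nonneg _),
        le_abs_self (v.re * g.re), abs_mul v.re g.re]
    have h2 : -(v.im * g.im) ≤ 0.02 * ‖v‖ * 0.1 := by
      have hgi : |g.im| ≤ 0.1 := (Complex.abs_im_le_norm g).trans hgn
      have := mul_le_mul hv hgi (abs_nonneg _) (by positivity)
      rw [← abs_mul] at this
      linarith [neg_abs_le (v.im * g.im)]
    nlinarith [norm_nonneg v]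
  have hb2 : ∀ n ∈ R2, (w n * g2 n).re ≤ 0.004 / 0.9998 * (w n).re := by
    intro n hn
    have hn' := Finset.mem_filter.mp hn
    obtain ⟨hn1, hnP⟩ := hNs n hn'.1
    have hgn : ‖g2 n‖ ≤ 0.1 := (factor_R2_le c' hD hℓ16 j hn'.2.1 hn'.2.2).trans (by norm_num)
    have hgr : |(g2 n).re| ≤ 0.002 := factor_R2_re_le c' hD hℓ16 j hn'.2.1 hn'.2.2
    obtain ⟨hwi, hwr⟩ := weight_im_re c' χ hℓ j hn1 hnP
    have := hterm (w n) (g2 n) hwi hgr hgn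
    nlinarith [norm_nonneg (w n)]
  have hb3 : ∀ n ∈ R3, (w n * g3 n).re ≤ 0.004 / 0.9998 * (w n).re := by
    intro n hn
    have hn' := Finset.mem_filter.mp hn
    obtain ⟨hn1, hnP⟩ := hNs n hn'.1
    have hgn : ‖g3 n‖ ≤ 0.1 := factor_R3_printed_le c' hD hℓ16 j hn'.2.1 hn'.2.2
    have hgr : |(g3 n).re| ≤ 0.002 := factor_R3_printed_re_le c' hD hℓ16 j hn'.2.1 hn'.2.2
    obtain ⟨hwi, hwr⟩ := weight_im_re c' χ hℓ j hn1 hnP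
    have := hterm (w n) (g3 n) hwi hgr hgn
    nlinarith [norm_nonneg (w n)]
  rw [e10, e11, e12, ← mul_add, Complex.re_ofReal_mul, Complex.re_ofReal_mul, Complex.add_re,
    Complex.add_re, Complex.re_sum, Complex.re_sum, Complex.re_sum, Complex.re_sum]
  have h2 : ∑ n ∈ R2, (w n + w n * g2 n).re ≤ (1 + 0.004 / 0.9998) * ∑ n ∈ R2, (w n).re := by
    rw [Finset.mul_sum]
    refine Finset.sum_le_sum fun n hn => ?_
    rw [Complex.add_re]
    linarith [hb2 n hn]
  have h3 : ∑ n ∈ R3, (w n + w n * g3 n).re ≤ (1 + 0.004 / 0.9998) * ∑ n ∈ R3, (w n).re := by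
    rw [Finset.mul_sum]
    refine Finset.sum_le_sum fun n hn => ?_
    rw [Complex.add_re]
    linarith [hb3 n hn]
  have := add_le_add h2 h3
  nlinarith [mul_le_mul_of_nonneg_left this hp0]

omit [NeZero D] χ in
/-- A threshold beyond which `D ≥ 3` and `𝓛⁷ ≥ 610000(1 + 16|c′|)`. [folklore] -/
private theorem exists_threshold' : ∃ D₁ : ℕ, ∀ D : ℕ, D₁ ≤ D →
    3 ≤ D ∧ 610000 * (1 + 16 * |c'|) ≤ ell D ^ 7 := by
  set K : ℝ := 610000 * (1 + 16 * |c'|) with hK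
  have hK0 : 0 ≤ K := by positivity
  refine ⟨⌈Real.exp (K ^ ((1:ℝ) / 7))⌉₊ + 3, fun D hD => ⟨by omega, ?_⟩⟩
  have hD1 : Real.exp (K ^ ((1:ℝ) / 7)) ≤ D := by
    have := Nat.ceil_le.mp (show ⌈Real.exp (K ^ ((1:ℝ) / 7))⌉₊ ≤ D by omega)
    exact_mod_cast this
  have hlog : K ^ ((1:ℝ) / 7) ≤ ell D := by
    rw [ell, ← Real.log_exp (K ^ ((1:ℝ) / 7))]
    exact Real.log_le_log (Real.exp_pos _) hD1
  have hk0 : 0 ≤ K ^ ((1:ℝ) / 7) := Real.rpow_nonneg hK0 _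
  calc K = (K ^ ((1:ℝ) / 7)) ^ 7 := by
        rw [← Real.rpow_natCast, ← Real.rpow_mul hK0]; norm_num
    _ ≤ ell D ^ 7 := pow_le_pow_left₀ hk0 hlog 7

/-- **Kernel edge `Z22:§18.u013` ⇐ the range evaluations AS PRINTED** (third range with `𝒴₁ⱼ`,
`Step18_u011`): the crude bound "`Re{S_j(𝐚₂₃,𝐚₂₃)} < 1100𝔞/log P`" follows from u008, u009,
"`dr < P^{0.5}` contributes `o(α)`", u010, u011 (verbatim), u012 — by the real-part refinement
(`re_main10_add_main11_le`: the first-order terms of the minor factors are purely imaginary, so only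
`0.4 %` survives in real part once `𝓛⁷ ≥ 610000(1 + 16|c′|)`), with `ε = a₀/4` (Lemma 5.7):
`Re S_j ≤ (1004.1 + 3.2)𝔞/log P < 1100𝔞/log P`. [cite: Zhang2022LandauSiegel, §18 p.100] -/
theorem step18_u013_of_ranges_printed (h8 : Step18_u008 c') (h9 : Step18_u009 c')
    (hr1 : Step18_range1 c') (h10 : Step18_u010 c') (h11 : Step18_u011 c') (h12 : Step18_u012 c') :
    Step18_u013 c' := by
  obtain ⟨a₀, ha₀, ha⟩ := frakALowerBound_holds
  obtain ⟨D₁, hD₁⟩ := exists_threshold' c'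
  set ε : ℝ := a₀ / 4 with hε
  have hε0 : 0 < ε := by positivity
  obtain ⟨D₀, hD₀⟩ :=
    (((((h8.and h9).and (hr1 ε hε0)).and (h10 ε hε0)).and (h11 ε hε0)).and (h12 ε hε0)).and ha
  refine ⟨max D₀ D₁, fun D _ χ hD hq hp hA j hj => ?_⟩
  obtain ⟨hD3, hℓ⟩ := hD₁ D (le_trans (le_max_right _ _) hD)
  obtain ⟨⟨⟨⟨⟨⟨e8, e9⟩, r1⟩, r10⟩, r11⟩, r12⟩, haa⟩ := hD₀ D χ (le_trans (le_max_left _ _) hD) hq hp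
  have hlogP : 0 < Real.log (bigP D) := by
    rw [log_bigP]; exact pow_pos (lt_trans one_pos (one_lt_ell hD3)) 9
  set ℓP := Real.log (bigP D) with hℓP
  have hα : alpha D = π / ℓP := by rw [alpha, ← hℓP]
  have haa' : a₀ ≤ frakA χ := haa hA
  have hfa : 0 < frakA χ := lt_of_lt_of_le ha₀ haa'
  have E8 := e8 j hj
  have E9 := e9 j hj
  have R1 := r1 hA j hj
  have R10 := r10 hA j hj
  have R11 := r11 hA j hj
  have R12 := r12 hA j hj
  have key := re_main10_add_main11_le c' χ hD3 hℓ hq hp j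
  set S1 := Sj23Range c' χ j 0 (bigP D ^ (0.5 : ℝ))
  set S2 := Sj23Range c' χ j (bigP D ^ (0.5 : ℝ)) (bigP D ^ (0.502 : ℝ))
  set S3 := Sj23Range c' χ j (bigP D ^ (0.502 : ℝ)) (bigP D ^ (0.504 : ℝ))
  set m10 := main18u010 c' χ j
  set m11 := main18u011 c' χ j
  set m12 := main18u012 c' χ j
  rw [E8, E9, Complex.add_re, Complex.add_re]
  have b1 : S1.re ≤ ε * alpha D := (Complex.re_le_norm _).trans R1
  have b2 : S2.re ≤ m10.re + ε * alpha D := by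
    have := Complex.re_le_norm (S2 - m10); rw [Complex.sub_re] at this; linarith
  have b3 : S3.re ≤ m11.re + ε * alpha D := by
    have := Complex.re_le_norm (S3 - m11); rw [Complex.sub_re] at this; linarith
  have b12 : m12.re ≤ 1000 * frakA χ / ℓP + ε * alpha D := by
    have := Complex.re_le_norm (m12 - ((1000 * frakA χ / ℓP : ℝ) : ℂ))
    rw [Complex.sub_re, Complex.ofReal_re] at this; linarith
  have hm : m10.re + m11.re ≤ (1 + 0.004 / 0.9998) * m12.re := by
    have := key; rwa [Complex.add_re] at this
  rw [hα] at b1 b2 b3 b12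
  have goal : ε * (π / ℓP) + (m10.re + ε * (π / ℓP)) + (m11.re + ε * (π / ℓP)) <
      1100 * frakA χ / ℓP := by
    have h1 : m10.re + m11.re ≤ (1 + 0.004 / 0.9998) * (1000 * frakA χ / ℓP + ε * (π / ℓP)) :=
      hm.trans (mul_le_mul_of_nonneg_left b12 (by norm_num))
    have h2 : (3 + (1 + 0.004 / 0.9998)) * (ε * (π / ℓP)) +
        (1 + 0.004 / 0.9998) * (1000 * frakA χ / ℓP) < 1100 * frakA χ / ℓP := by
      rw [hε]
      have hπ := Real.pi_lt_d2
      rw [show (3 + (1 + 0.004 / 0.9998)) * (a₀ / 4 * (π / ℓP)) +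
            (1 + 0.004 / 0.9998) * (1000 * frakA χ / ℓP) =
          ((3 + (1 + 0.004 / 0.9998)) * (a₀ / 4) * π + (1 + 0.004 / 0.9998) * 1000 * frakA χ) / ℓP
          by ring]
      rw [div_lt_div_iff_of_pos_right hlogP]
      nlinarith [mul_le_mul_of_nonneg_right haa' Real.pi_pos.le]
    linarith
  linarith

end PrintedCrude

end Literature.NumberTheory.LFunctions.Zhang2022.Typed.Section18
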